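import Mathlib
import Summits.ResolutionOfSingularities.ResolutionOfSingularities.Theorems.RadicialJungCleanModelsPBasisFieldExchange
import Summits.ResolutionOfSingularities.ResolutionOfSingularities.Theorems.RadicialJungCleanModelsPBasisDualDerivations
import Summits.ResolutionOfSingularities.ResolutionOfSingularities.Theorems.RadicialJungCleanModelsPBasisDerivation
import Summits.ResolutionOfSingularities.ResolutionOfSingularities.Theorems.RadicialJungCleanModelsCleanLU3ArcDischarge
import Summits.ResolutionOfSingularities.ResolutionOfSingularities.Theorems.RadicialJungCleanModelsCleanLU3ArcTower
import Literature.AlgebraicGeometry.Resolution.TranscendenceDefect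
import HarnessLib

/-!
# res-B-lens-5 g7 (lens 5): UNION certificate — the three class-(A) arc stubs of CleanModels `Lines/Sketch.lean` rev 20 VERBATIM, no hypotheses

Crux of record: stmt-ResolutionOfSingularities-0549 `Theses.Descent.DescentPerfectToAll` (FIXED, not restated); 15917-side support.
This module is the CONCATENATION (each part closed by `end`) of the three sorry-free crux workfiles of record
`Lens5_DerivationOfNotMemAdjoinPow.lean` (5d37f7a70d6b), `Lens5_AbsDerivation.lean` (d237cf907357) and `Lens5_ArcPotential.lean`
(66960002e3bd) — Cruxes modules cannot import one another on the farm — followed by §UNION: the statements of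
`stub_derivation_of_not_mem_adjoin_pow` (Sketch l.220), `stub_cleanLU3DefectArcConstants` (l.232) and `stub_cleanLU3DefectArcInfinite` (l.186),
copied VERBATIM from `Cruxes/CleanModels/Lines/Sketch.lean` rev 20 (0ed627d06d47d46d), each proved with NO extra hypothesis in ONE kernel run.
The three component files remain the sources of record (edit those, regenerate this).
Rev 2/3 (§REV21 after Sketch rev 21 = 9a6912239ef4; §REV22 after rev 22 = a20320932482, `¬ PerfectField k` inserted): also the two rev-21 class-(A) stubs VERBATIM — `stub_cleanLU3DefectArcImperfect` (THEOREM P,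
dropping its two extra hypotheses) and rev-21 `stub_cleanLU3DefectArcConstants` (EX FALSO from D-abs: its «no derivation» hypothesis is contradictory).
bears_on: LADDER-RESOLUTION:B · [OURS · CANDIDATE] counted 0; nothing here proves resolution in characteristic `p`.
-/

-- ════════ PART 1: Lens5_DerivationOfNotMemAdjoinPow.lean (5d37f7a70d6b) ════════
noncomputable section

set_option linter.dupNamespace false

open Literature.RingTheory.PBasis
open Summit.ResolutionOfSingularities.ResolutionOfSingularities.Theorems.RadicialJung.CleanModels

namespace Summit.ResolutionOfSingularities.ResolutionOfSingularities.Cruxes.DescentPerfectToAll.CpSibling.DerivationStub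

section Tools

variable {K : Type} [Field K] (p : ℕ) [Fact p.Prime] [CharP K p]

/-- The empty family is `p`-independent. [folklore] -/
theorem pIndep_empty : ∀ (s : ℕ) (b : Fin s → K), Function.Injective b → (∀ i, b i ∈ (∅ : Set K)) →
    LinearIndependent (frobenius K p).range (fun n : Fin s → Fin p => ∏ i, b i ^ (n i : ℕ)) := by
  intro s b _ hmem
  rcases Nat.eq_zero_or_pos s with rfl | hs
  · rw [Fintype.linearIndependent_iff]
    intro g hg n
    rw [Finset.sum_eq_single n (fun n' _ hn' => absurd (Subsingleton.elim n' n) hn')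
      (fun h => absurd (Finset.mem_univ n) h)] at hg
    simp only [Finset.univ_eq_empty, Finset.prod_empty, Subring.smul_def, smul_eq_mul,
      mul_one] at hg
    exact Subtype.ext hg
  · exact absurd (hmem ⟨0, hs⟩) (Set.notMem_empty _)

/-- A `p`-independent generating set is a `p`-basis over `K^p` (`IsPBasisOver`). [folklore] -/
theorem isPBasisOver_of_pIndep_of_univ_subset {Γ : Set K}
    (hind : ∀ (s : ℕ) (b : Fin s → K), Function.Injective b → (∀ i, b i ∈ Γ) →
      LinearIndependent (frobenius K p).range (fun n : Fin s → Fin p => ∏ i, b i ^ (n i : ℕ)))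
    (hgen : Set.univ ⊆ (Subring.closure (Set.range (frobenius K p) ∪ Γ) : Set K)) :
    IsPBasisOver p (frobenius K p).range Γ := by
  refine ⟨?_, hind⟩
  rw [eq_top_iff]
  intro x _
  rw [Algebra.mem_adjoin_iff]
  have hr : Set.range (algebraMap (frobenius K p).range K) = Set.range (frobenius K p) := by
    ext z
    constructor
    · rintro ⟨⟨w, y, hy⟩, rfl⟩
      exact ⟨y, hy⟩
    · rintro ⟨y, rfl⟩
      exact ⟨⟨frobenius K p y, y, rfl⟩, rfl⟩
  rw [hr]
  exact hgen (Set.mem_univ x)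

/-- A derivation killing `B` kills `K^p[B] = Subring.closure (K^p ∪ B)`. [folklore] -/
theorem derivation_eq_zero_of_mem_closure (D : Derivation ℤ K K) {B : Set K} (hB : ∀ b ∈ B, D b = 0)
    {x : K} (hx : x ∈ Subring.closure (Set.range (frobenius K p) ∪ B)) : D x = 0 := by
  induction hx using Subring.closure_induction with
  | mem y hy =>
    rcases hy with ⟨w, rfl⟩ | hy
    · rw [frobenius_def]
      exact derivation_pow_char D w
    · exact hB y hy
  | zero => exact map_zero D
  | one => exact D.map_one_eq_zero
  | add a b _ _ ha hb => rw [map_add, ha, hb, add_zero]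
  | neg a _ ha => rw [map_neg, ha, neg_zero]
  | mul a b _ _ ha hb => rw [D.leibniz, ha, hb, smul_zero, smul_zero, add_zero]

end Tools

/-- **The stub `stub_derivation_of_not_mem_adjoin_pow`, proved** (statement copied verbatim from `Cruxes/CleanModels/Lines/Sketch.lean`
rev 20): if `g₀ ∉ k[K^p]` there is a derivation `D` of `K = Frac A` with `D g₀ ≠ 0` and `s • D (A) ⊆ A` for some `s ≠ 0`.
[folklore] -/
theorem derivation_of_not_mem_adjoin_pow :
    ∀ (p : ℕ), p.Prime →
    ∀ (k : Type) [Field k] [CharP k p] (K : Type) [Field K] [Algebra k K] (A : Subalgebra k K), A.FG → IsFractionRing A K →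
    ∀ g₀ : K, g₀ ∉ Algebra.adjoin k (Set.range fun y : K => y ^ p) →
    ∃ (D : Derivation ℤ K K) (s : K), s ≠ 0 ∧ (∀ y : K, y ∈ A → s * D y ∈ A) ∧ D g₀ ≠ 0 := by
  intro p hp k _ _ K _ _ A hAfg hfrac g₀ hg₀
  classical
  haveI : Fact p.Prime := ⟨hp⟩
  haveI : CharP K p := charP_of_injective_algebraMap (algebraMap k K).injective p
  haveI := hfrac
  -- Step 1: a maximal `p`-independent subset `B₁` of the image `k'` of `k`
  obtain ⟨B₁, -, hB₁k, hB₁ind, hk'B₁⟩ :=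
    exists_maximal_pIndep p (Set.range (algebraMap k K)) ∅ (Set.empty_subset _) (pIndep_empty p)
  -- Step 2: `K^p[B₁] ⊆ k[K^p] ∌ g₀`
  have hle : Subring.closure (Set.range (frobenius K p) ∪ B₁) ≤
      (Algebra.adjoin k (Set.range fun y : K => y ^ p)).toSubring := by
    rw [Subring.closure_le]
    rintro x (⟨y, rfl⟩ | hx)
    · exact Algebra.subset_adjoin ⟨y, (frobenius_def ..).symm⟩
    · obtain ⟨c, rfl⟩ := hB₁k hx
      exact Subalgebra.algebraMap_mem _ c
  have hg₀B₁ : g₀ ∉ Subring.closure (Set.range (frobenius K p) ∪ B₁) := fun h => hg₀ (hle h)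
  -- Step 3: `B₁ ∪ {g₀}` is `p`-independent and extends to a `p`-basis `Γ`
  have hB₂ind := pIndep_insert p B₁ hB₁ind hg₀B₁
  obtain ⟨Γ, hB₂Γ, -, hΓind, hΓgen⟩ :=
    exists_maximal_pIndep p Set.univ (insert g₀ B₁) (Set.subset_univ _) hB₂ind
  have hΓ : IsPBasisOver p (frobenius K p).range Γ := isPBasisOver_of_pIndep_of_univ_subset p hΓind hΓgen
  have hg₀Γ : g₀ ∈ Γ := hB₂Γ (Set.mem_insert _ _)
  -- Step 4: the dual derivation at `g₀`
  obtain ⟨D, hDg₀, hDΓ⟩ := IsPBasisOver.exists_dual_derivation hΓ ⟨g₀, hg₀Γ⟩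
  -- Step 5: `D` kills `B₁`, hence `k' ⊆ K^p[B₁]`
  have hDB₁ : ∀ b ∈ B₁, D b = 0 := by
    intro b hb
    have hbΓ : b ∈ Γ := hB₂Γ (Set.mem_insert_of_mem _ hb)
    have hne : (⟨b, hbΓ⟩ : Γ) ≠ ⟨g₀, hg₀Γ⟩ := by
      intro h
      have hbg : b = g₀ := congrArg Subtype.val h
      exact hg₀B₁ (hbg ▸ Subring.subset_closure (Or.inr hb))
    exact hDΓ ⟨b, hbΓ⟩ hne
  have hDk : ∀ c : k, D (algebraMap k K c) = 0 := fun c =>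
    derivation_eq_zero_of_mem_closure p D hDB₁ (hk'B₁ ⟨c, rfl⟩)
  -- Step 6: denominators on the finitely generated `A = k[t]`
  obtain ⟨t, ht⟩ := hAfg
  have hfr := fun x : K => IsFractionRing.div_surjective (A := A) (D x)
  choose a b hb hab using hfr
  have halg : ∀ z : A, algebraMap A K z = (z : K) := fun z => rfl
  have hb0 : ∀ x, ((b x : A) : K) ≠ 0 := fun x h =>
    nonZeroDivisors.ne_zero (hb x) (Subtype.ext h)
  have hDx : ∀ x, D x = ((a x : A) : K) / ((b x : A) : K) := fun x => by
    rw [← halg, ← halg, hab]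
  set s : K := ∏ x ∈ t, ((b x : A) : K) with hs
  have hs0 : s ≠ 0 := Finset.prod_ne_zero_iff.mpr fun x _ => hb0 x
  have hA : ∀ z : A, (z : K) ∈ Algebra.adjoin k (↑t : Set K) := fun z => by rw [ht]; exact z.2
  have hmain : ∀ y : K, y ∈ Algebra.adjoin k (↑t : Set K) → s * D y ∈ Algebra.adjoin k (↑t : Set K) := by
    intro y hy
    induction hy using Algebra.adjoin_induction with
    | mem x hx =>
      have hx' : x ∈ t := by exact_mod_cast hx
      rw [hDx x, hs, ← Finset.mul_prod_erase t (fun x => ((b x : A) : K)) hx']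
      have h1 : ((b x : A) : K) * (∏ z ∈ t.erase x, ((b z : A) : K)) * (((a x : A) : K) / ((b x : A) : K)) =
          (∏ z ∈ t.erase x, ((b z : A) : K)) * ((a x : A) : K) := by
        rw [mul_comm ((b x : A) : K), mul_assoc, mul_div_assoc', mul_div_cancel_left₀ _ (hb0 x)]
      rw [h1]
      exact Subalgebra.mul_mem _ (Subalgebra.prod_mem _ fun z _ => hA (b z)) (hA (a x))
    | algebraMap r =>
      rw [hDk, mul_zero]
      exact Subalgebra.zero_mem _
    | add x y _ _ hx' hy' =>
      rw [map_add, mul_add]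
      exact Subalgebra.add_mem _ hx' hy'
    | mul x y hx hy hx' hy' =>
      have h1 : s * D (x * y) = x * (s * D y) + y * (s * D x) := by
        rw [D.leibniz, smul_eq_mul, smul_eq_mul]
        ring
      rw [h1]
      exact Subalgebra.add_mem _ (Subalgebra.mul_mem _ hx hy') (Subalgebra.mul_mem _ hy hx')
  refine ⟨D, s, hs0, fun y hy => ?_, ?_⟩
  · rw [← ht] at hy ⊢
    exact hmain y hy
  · rw [hDg₀]
    exact one_ne_zero

end Summit.ResolutionOfSingularities.ResolutionOfSingularities.Cruxes.DescentPerfectToAll.CpSibling.DerivationStub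

end

-- ════════ PART 2: Lens5_AbsDerivation.lean (d237cf907357) ════════
noncomputable section

set_option linter.dupNamespace false

open Polynomial
open IsLocalRing
open Literature.AlgebraicGeometry.Resolution
open Literature.RingTheory.PBasis
open Summit.ResolutionOfSingularities.ResolutionOfSingularities.Theorems.RadicialJung.CleanModels

namespace Summit.ResolutionOfSingularities.ResolutionOfSingularities.Cruxes.DescentPerfectToAll.CpSibling.AbsDerivation

section Tools

variable {K : Type} [Field K] (p : ℕ) [Fact p.Prime] [CharP K p]

/-- The empty family is `p`-independent. [folklore] -/
theorem pIndep_empty : ∀ (s : ℕ) (b : Fin s → K), Function.Injective b → (∀ i, b i ∈ (∅ : Set K)) →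
    LinearIndependent (frobenius K p).range (fun n : Fin s → Fin p => ∏ i, b i ^ (n i : ℕ)) := by
  intro s b _ hmem
  rcases Nat.eq_zero_or_pos s with rfl | hs
  · rw [Fintype.linearIndependent_iff]
    intro g hg n
    rw [Finset.sum_eq_single n (fun n' _ hn' => absurd (Subsingleton.elim n' n) hn')
      (fun h => absurd (Finset.mem_univ n) h)] at hg
    simp only [Finset.univ_eq_empty, Finset.prod_empty, Subring.smul_def, smul_eq_mul,
      mul_one] at hg
    exact Subtype.ext hg
  · exact absurd (hmem ⟨0, hs⟩) (Set.notMem_empty _)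

/-- A `p`-independent generating set is a `p`-basis over `K^p` (`IsPBasisOver`). [folklore] -/
theorem isPBasisOver_of_pIndep_of_univ_subset {Γ : Set K}
    (hind : ∀ (s : ℕ) (b : Fin s → K), Function.Injective b → (∀ i, b i ∈ Γ) →
      LinearIndependent (frobenius K p).range (fun n : Fin s → Fin p => ∏ i, b i ^ (n i : ℕ)))
    (hgen : Set.univ ⊆ (Subring.closure (Set.range (frobenius K p) ∪ Γ) : Set K)) :
    IsPBasisOver p (frobenius K p).range Γ := by
  refine ⟨?_, hind⟩
  rw [eq_top_iff]
  intro x _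
  rw [Algebra.mem_adjoin_iff]
  have hr : Set.range (algebraMap (frobenius K p).range K) = Set.range (frobenius K p) := by
    ext z
    constructor
    · rintro ⟨⟨w, y, hy⟩, rfl⟩
      exact ⟨y, hy⟩
    · rintro ⟨y, rfl⟩
      exact ⟨⟨frobenius K p y, y, rfl⟩, rfl⟩
  rw [hr]
  exact hgen (Set.mem_univ x)

/-- A derivation killing `B` kills `K^p[B] = Subring.closure (K^p ∪ B)`. [folklore] -/
theorem derivation_eq_zero_of_mem_closure (D : Derivation ℤ K K) {B : Set K} (hB : ∀ b ∈ B, D b = 0)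
    {x : K} (hx : x ∈ Subring.closure (Set.range (frobenius K p) ∪ B)) : D x = 0 := by
  induction hx using Subring.closure_induction with
  | mem y hy =>
    rcases hy with ⟨w, rfl⟩ | hy
    · rw [frobenius_def]
      exact derivation_pow_char D w
    · exact hB y hy
  | zero => exact map_zero D
  | one => exact D.map_one_eq_zero
  | add a b _ _ ha hb => rw [map_add, ha, hb, add_zero]
  | neg a _ ha => rw [map_neg, ha, neg_zero]
  | mul a b _ _ ha hb => rw [D.leibniz, ha, hb, smul_zero, smul_zero, add_zero]

end Tools

/-! ## LEMMA F₀ (pure field theory, Mathlib only) -/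

namespace LemmaF0

variable {K : Type} [Field K]

theorem range_algebraMap_subfield (F : Subfield K) : Set.range (algebraMap F K) = (F : Set K) := by
  ext z
  constructor
  · rintro ⟨c, rfl⟩
    exact c.2
  · intro hz
    exact ⟨⟨z, hz⟩, rfl⟩

theorem mem_closure_iff_mem_adjoin (F : Subfield K) (x₀ z : K) :
    z ∈ Subfield.closure ((F : Set K) ∪ {x₀}) ↔ z ∈ IntermediateField.adjoin F ({x₀} : Set K) := by
  rw [← IntermediateField.mem_toSubfield, IntermediateField.adjoin_toSubfield, range_algebraMap_subfield]

/-- (i) If `x₀` is algebraic over `F`, then `F(x₀)` is contained in a finite `F`-span. [folklore] -/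
theorem exists_span_of_isAlgebraic (F : Subfield K) {x₀ : K} (hx : IsAlgebraic F x₀) :
    ∃ (d : ℕ) (ρ : Fin d → K), ∀ z ∈ Subfield.closure ((F : Set K) ∪ {x₀}),
      ∃ b : Fin d → K, (∀ i, b i ∈ F) ∧ z = ∑ i, b i * ρ i := by
  have hint : IsIntegral F x₀ := isAlgebraic_iff_isIntegral.mp hx
  let pb := IntermediateField.adjoin.powerBasis hint
  refine ⟨pb.dim, fun i => (pb.basis i : K), fun z hz => ?_⟩
  rw [mem_closure_iff_mem_adjoin] at hz
  refine ⟨fun i => (pb.basis.repr ⟨z, hz⟩ i : K), fun i => Subtype.coe_prop _, ?_⟩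
  have key := congrArg (fun y : IntermediateField.adjoin F ({x₀} : Set K) => (y : K))
    (pb.basis.sum_repr ⟨z, hz⟩)
  simp only at key
  calc z = _ := key.symm
    _ = _ := by
      rw [IntermediateField.coe_sum]
      refine Finset.sum_congr rfl fun i _ => ?_
      rw [IntermediateField.coe_smul, Algebra.smul_def]
      rfl

/-- (ii) If `x₀` is transcendental over `F`, `F ≤ M` with `M^p ⊆ F`, then an `F`-linearly independent family of elements
of `M` stays `F(x₀)`-linearly independent. [folklore] -/
theorem linearIndependent_adjoin_of_transcendental {p : ℕ} [Fact p.Prime] [CharP K p]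
    (F M : Subfield K) (hFM : F ≤ M) (hMp : ∀ y ∈ M, y ^ p ∈ F) {x₀ : K} (hx : Transcendental F x₀)
    {ι : Type} [Fintype ι] {ν : ι → K} (hνM : ∀ i, ν i ∈ M) (hind : LinearIndependent F ν) :
    LinearIndependent (Subfield.closure ((F : Set K) ∪ {x₀})) ν := by
  classical
  have hp : p.Prime := Fact.out
  set F' := Subfield.closure ((F : Set K) ∪ {x₀}) with hF'
  rw [Fintype.linearIndependent_iff] at hind ⊢
  intro c hc
  have hc' : ∑ i, ((c i : F') : K) * ν i = 0 := by
    simp_rw [Algebra.smul_def] at hc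
    exact hc
  -- each `c i = P/Q` with `Q(x₀) ≠ 0`
  have hPQ : ∀ i, ∃ P Q : (F)[X], aeval x₀ Q ≠ 0 ∧ ((c i : F') : K) = aeval x₀ P / aeval x₀ Q := by
    intro i
    obtain ⟨P, Q, h⟩ := (IntermediateField.mem_adjoin_simple_iff (F := F) (α := x₀) ((c i : F') : K)).mp
      ((mem_closure_iff_mem_adjoin F x₀ _).mp (c i).2)
    by_cases hQ : aeval x₀ Q = 0
    · refine ⟨0, 1, by simp, ?_⟩
      rw [h, hQ, div_zero, map_zero, map_one, zero_div]
    · exact ⟨P, Q, hQ, h⟩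
  choose P Q hQ hcPQ using hPQ
  -- clear denominators: `R i := P i * ∏_{i' ≠ i} Q i'`, `aeval x₀ (R i) = c i * D`
  set R : ι → (F)[X] := fun i => P i * ∏ i' ∈ Finset.univ.erase i, Q i' with hR
  have hRc : ∀ i, aeval x₀ (R i) = ((c i : F') : K) * ∏ i', aeval x₀ (Q i') := by
    intro i
    simp only [hR, map_mul, map_prod]
    rw [hcPQ i, ← Finset.mul_prod_erase Finset.univ (fun i' => aeval x₀ (Q i')) (Finset.mem_univ i),
      div_mul_eq_mul_div, mul_left_comm, mul_div_cancel_left₀ _ (hQ i)]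
  have hrel : ∑ i, aeval x₀ (R i) * ν i = 0 := by
    simp_rw [hRc, mul_right_comm _ _ (ν _)]
    rw [← Finset.sum_mul, hc', zero_mul]
  -- expand in powers of `x₀`
  set N := Finset.univ.sup (fun i => (R i).natDegree) + 1 with hN
  have hdeg : ∀ i, (R i).natDegree < N := fun i =>
    Nat.lt_succ_of_le (Finset.le_sup (f := fun i => (R i).natDegree) (Finset.mem_univ i))
  have hexp : ∀ i, aeval x₀ (R i) = ∑ d ∈ Finset.range N, (((R i).coeff d : F) : K) * x₀ ^ d := by
    intro i
    rw [aeval_eq_sum_range' (hdeg i)]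
    refine Finset.sum_congr rfl fun d _ => ?_
    rw [Algebra.smul_def]
    rfl
  set m : ℕ → K := fun d => ∑ i, (((R i).coeff d : F) : K) * ν i with hm
  have hmM : ∀ d, m d ∈ M := fun d =>
    sum_mem fun i _ => mul_mem (hFM ((R i).coeff d).2) (hνM i)
  have hsum : ∑ d ∈ Finset.range N, m d * x₀ ^ d = 0 := by
    rw [← hrel]
    simp_rw [hexp, hm, Finset.sum_mul]
    rw [Finset.sum_comm]
    refine Finset.sum_congr rfl fun i _ => Finset.sum_congr rfl fun d _ => ?_
    ring
  -- Frobenius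
  have hsum' : ∑ d ∈ Finset.range N, (m d) ^ p * (x₀ ^ p) ^ d = 0 := by
    have h := congrArg (frobenius K p) hsum
    rw [map_sum, map_zero] at h
    rw [← h]
    refine Finset.sum_congr rfl fun d _ => ?_
    rw [frobenius_def, mul_pow, ← pow_mul, ← pow_mul, mul_comm p d]
  have hmF : ∀ d, (m d) ^ p ∈ F := fun d => hMp _ (hmM d)
  set Φ : (F)[X] := ∑ d ∈ Finset.range N, C (⟨(m d) ^ p, hmF d⟩ : F) * X ^ d with hΦ
  have hΦeval : aeval (x₀ ^ p) Φ = 0 := by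
    rw [hΦ, map_sum, ← hsum']
    refine Finset.sum_congr rfl fun d _ => ?_
    rw [map_mul, map_pow, aeval_C, aeval_X]
    rfl
  have hxp : Transcendental F (x₀ ^ p) := hx.pow hp.pos
  have hΦ0 : Φ = 0 := (transcendental_iff_injective.mp hxp) (by rw [hΦeval, map_zero])
  have hmd : ∀ d ∈ Finset.range N, m d = 0 := by
    intro d hd
    have hcoef : Φ.coeff d = ⟨(m d) ^ p, hmF d⟩ := by
      rw [hΦ, finsetSum_coeff]
      simp_rw [coeff_C_mul_X_pow]
      rw [Finset.sum_ite_eq, if_pos hd]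
    rw [hΦ0, coeff_zero] at hcoef
    have h0 : (m d) ^ p = 0 := by
      have := congrArg Subtype.val hcoef
      simpa using this.symm
    exact (pow_eq_zero_iff hp.ne_zero).mp h0
  -- all coefficients of `R i` vanish
  have hcoeff : ∀ i d, (R i).coeff d = 0 := by
    intro i d
    by_cases hd : d < N
    · have h0 : ∑ i, (((R i).coeff d : F) : K) * ν i = 0 := hmd d (Finset.mem_range.mpr hd)
      refine hind (fun i => (R i).coeff d) ?_ i
      simp_rw [Algebra.smul_def]
      exact h0
    · exact coeff_eq_zero_of_natDegree_lt (lt_of_lt_of_le (hdeg i) (not_lt.mp hd))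
  have hR0 : ∀ i, R i = 0 := fun i => Polynomial.ext fun d => by rw [hcoeff, coeff_zero]
  have hQ0 : ∀ i, Q i ≠ 0 := fun i h => hQ i (by rw [h, map_zero])
  have hP0 : ∀ i, P i = 0 := by
    intro i
    have h := hR0 i
    simp only [hR] at h
    exact (mul_eq_zero.mp h).resolve_right (Finset.prod_ne_zero_iff.mpr fun i' _ => hQ0 i')
  intro i
  apply Subtype.ext
  rw [hcPQ i, hP0, map_zero, zero_div]
  rfl

/-- LEMMA F₀, general-index form, by induction on the generators. -/
theorem finite_span_aux {p : ℕ} [Fact p.Prime] [CharP K p] (w : Finset K) :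
    ∀ (F M : Subfield K), F ≤ M → (∀ x ∈ M, x ^ p ∈ F) →
      (M : Set K) ⊆ (Subfield.closure ((F : Set K) ∪ ↑w) : Set K) →
      ∃ (ι : Type) (_ : Fintype ι) (μ : ι → K), ∀ x ∈ M, ∃ a : ι → K, (∀ i, a i ∈ F) ∧ x = ∑ i, a i * μ i := by
  classical
  induction w using Finset.induction_on with
  | empty =>
    intro F M hFM hMp hMw
    refine ⟨Unit, inferInstance, fun _ => 1, fun x hx => ⟨fun _ => x, fun _ => ?_, by simp⟩⟩
    have : x ∈ Subfield.closure ((F : Set K) ∪ ↑(∅ : Finset K)) := hMw hx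
    rwa [Finset.coe_empty, Set.union_empty, Subfield.closure_eq] at this
  | insert x₀ w _ ih =>
    intro F M hFM hMp hMw
    set F' : Subfield K := Subfield.closure ((F : Set K) ∪ {x₀}) with hF'def
    have hFF' : F ≤ F' := fun z hz => Subfield.subset_closure (Or.inl hz)
    have hx₀F' : x₀ ∈ F' := Subfield.subset_closure (Or.inr rfl)
    set M' : Subfield K := M ⊔ F' with hM'def
    have hF'M' : F' ≤ M' := le_sup_right
    have hMM' : M ≤ M' := le_sup_left
    have hM'p : ∀ y ∈ M', y ^ p ∈ F' := by
      have hle : M' ≤ F'.comap (frobenius K p) := by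
        refine sup_le (fun y hy => ?_) (fun y hy => ?_)
        · rw [Subfield.mem_comap, frobenius_def]
          exact hFF' (hMp y hy)
        · rw [Subfield.mem_comap, frobenius_def]
          exact pow_mem hy p
      intro y hy
      have := hle hy
      rwa [Subfield.mem_comap, frobenius_def] at this
    have hM'w : (M' : Set K) ⊆ (Subfield.closure ((F' : Set K) ∪ ↑w) : Set K) := by
      have hle : M' ≤ Subfield.closure ((F' : Set K) ∪ ↑w) := by
        refine sup_le (fun y hy => ?_) (fun y hy => Subfield.subset_closure (Or.inl hy))
        refine Subfield.closure_mono ?_ (hMw hy)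
        rintro z (hz | hz)
        · exact Or.inl (hFF' hz)
        · rw [Finset.coe_insert, Set.mem_insert_iff] at hz
          rcases hz with rfl | hz
          · exact Or.inl hx₀F'
          · exact Or.inr hz
      exact hle
    obtain ⟨ι, _, μ, hμ⟩ := ih F' M' hF'M' hM'p hM'w
    by_cases halg : IsAlgebraic F x₀
    · -- algebraic generator: compose the two finite spans
      obtain ⟨d, ρ, hρ⟩ := exists_span_of_isAlgebraic F halg
      refine ⟨ι × Fin d, inferInstance, fun ji => ρ ji.2 * μ ji.1, fun x hx => ?_⟩
      obtain ⟨a, haF', hxa⟩ := hμ x (hMM' hx)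
      choose b hbF hab using fun j => hρ (a j) (haF' j)
      refine ⟨fun ji => b ji.1 ji.2, fun ji => hbF _ _, ?_⟩
      rw [hxa, Fintype.sum_prod_type]
      refine Finset.sum_congr rfl fun j _ => ?_
      rw [hab j, Finset.sum_mul]
      refine Finset.sum_congr rfl fun i _ => ?_
      ring
    · -- transcendental generator: rank argument
      have htr : Transcendental F x₀ := halg
      let MF : Submodule F K :=
        { carrier := M
          add_mem' := fun ha hb => M.add_mem ha hb
          zero_mem' := M.zero_mem
          smul_mem' := fun c x hx => by
            rw [Algebra.smul_def]
            exact M.mul_mem (hFM c.2) hx }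
      haveI : Module.Finite F' (Submodule.span F' (Set.range μ)) :=
        Module.Finite.span_of_finite _ (Set.finite_range μ)
      have hbound : ∀ s : Finset MF, (LinearIndependent F fun i : s => (i : MF)) →
          s.card ≤ Fintype.card ι := by
        intro s hli
        let ν : s → K := fun i => ((i : MF) : K)
        have hνM : ∀ i, ν i ∈ M := fun i => (i : MF).2
        have hν : LinearIndependent F ν := hli.map' MF.subtype (Submodule.ker_subtype MF)
        have hν' := linearIndependent_adjoin_of_transcendental F M hFM hMp htr hνM hν
        have hνW : ∀ i, ν i ∈ Submodule.span F' (Set.range μ) := by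
          intro i
          obtain ⟨a, haF', h⟩ := hμ (ν i) (hMM' (hνM i))
          rw [h]
          refine Submodule.sum_mem _ fun j _ => ?_
          have h1 : a j * μ j = (⟨a j, haF' j⟩ : F') • μ j := by
            rw [Algebra.smul_def]
            rfl
          rw [h1]
          exact Submodule.smul_mem _ _ (Submodule.subset_span (Set.mem_range_self j))
        let ν' : s → Submodule.span F' (Set.range μ) := fun i => ⟨ν i, hνW i⟩
        have hν'ind : LinearIndependent F' ν' :=
          LinearIndependent.of_comp (Submodule.span F' (Set.range μ)).subtype hν'
        have h1 := hν'ind.fintype_card_le_finrank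
        have h2 := finrank_range_le_card (R := F') μ
        rw [Fintype.card_coe] at h1
        exact h1.trans h2
      have hrank : Module.rank F MF ≤ Fintype.card ι := rank_le hbound
      haveI : Module.Free F MF := Module.Free.of_divisionRing F MF
      haveI : Module.Finite F MF := by
        rw [← Module.rank_lt_aleph0_iff]
        exact lt_of_le_of_lt hrank (Cardinal.natCast_lt_aleph0 (n := Fintype.card ι))
      obtain ⟨n, s, hs⟩ := Module.Finite.exists_fin (R := F) (M := MF)
      refine ⟨Fin n, inferInstance, fun i => (s i : K), fun x hx => ?_⟩
      have hxs : (⟨x, hx⟩ : MF) ∈ Submodule.span F (Set.range s) := by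
        rw [hs]
        exact Submodule.mem_top
      rw [Submodule.mem_span_range_iff_exists_fun] at hxs
      obtain ⟨c, hc⟩ := hxs
      refine ⟨fun i => (c i : K), fun i => (c i).2, ?_⟩
      have h := congrArg (fun y : MF => (y : K)) hc
      simp only at h
      rw [← h, Submodule.coe_sum]
      refine Finset.sum_congr rfl fun i _ => ?_
      rw [Submodule.coe_smul, Algebra.smul_def]
      rfl

/-- **LEMMA F₀.** [folklore] -/
theorem heightOneIntermediateFinite (p : ℕ) (hp : p.Prime) :
    ∀ (K : Type) [Field K] [CharP K p] (F M : Subfield K) (w : Finset K),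
      F ≤ M → (∀ x ∈ M, x ^ p ∈ F) → (M : Set K) ⊆ (Subfield.closure ((F : Set K) ∪ ↑w) : Set K) →
      ∃ (f : ℕ) (μ : Fin f → K), ∀ x ∈ M, ∃ a : Fin f → K, (∀ j, a j ∈ F) ∧ x = ∑ j, a j * μ j := by
  intro K _ _ F M w hFM hMp hMw
  haveI : Fact p.Prime := ⟨hp⟩
  classical
  obtain ⟨ι, _, μ, hμ⟩ := finite_span_aux w F M hFM hMp hMw
  refine ⟨Fintype.card ι, fun j => μ ((Fintype.equivFin ι).symm j), fun x hx => ?_⟩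
  obtain ⟨a, haF, hxa⟩ := hμ x hx
  refine ⟨fun j => a ((Fintype.equivFin ι).symm j), fun j => haF _, ?_⟩
  rw [hxa]
  exact (Equiv.sum_comp (Fintype.equivFin ι).symm (fun i => a i * μ i)).symm

end LemmaF0


/-- **LEMMA F₀ (hypothesis).**  Height-one purely inseparable intermediate fields of a finitely generated extension are finite:
if `F ≤ M` are subfields of `K` (characteristic `p`), `x^p ∈ F` for every `x ∈ M`, and `M ⊆ F(w)` for a finite `w ⊆ K`, then `M` is
contained in the `F`-span of finitely many elements.  [folklore] (intermediate fields of finitely generated extensions are finitely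
generated; algebraic + finitely generated ⟹ finite.)  Used only for prime `p`. -/
def HeightOneIntermediateFinite (p : ℕ) : Prop :=
  ∀ (K : Type) [Field K] [CharP K p] (F M : Subfield K) (w : Finset K),
    F ≤ M → (∀ x ∈ M, x ^ p ∈ F) → (M : Set K) ⊆ (Subfield.closure ((F : Set K) ∪ ↑w) : Set K) →
    ∃ (f : ℕ) (μ : Fin f → K), ∀ x ∈ M, ∃ a : Fin f → K, (∀ j, a j ∈ F) ∧ x = ∑ j, a j * μ j

/-- **LEMMA D-abs from LEMMA F₀.**  For a finitely generated `k`-algebra `A` with fraction field `K` (characteristic `p`) and `g₀ ∈ K`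
not a `p`-th power, there is a derivation `D` of `K` (over `ℤ`; in general NOT `k`-linear) with `D g₀ ≠ 0` and `s • D(A) ⊆ A` for some
`s ≠ 0`. [folklore] -/
theorem absDerivation_of_forall_pow_ne (p : ℕ) (hp : p.Prime) (hF : HeightOneIntermediateFinite p)
    (k : Type) [Field k] [CharP k p] (K : Type) [Field K] [Algebra k K] (A : Subalgebra k K)
    (hAfg : A.FG) (hfrac : IsFractionRing A K) (g₀ : K) (hg : ∀ c : K, c ^ p ≠ g₀) :
    ∃ (D : Derivation ℤ K K) (s : K), s ≠ 0 ∧ (∀ y : K, y ∈ A → s * D y ∈ A) ∧ D g₀ ≠ 0 := by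
  classical
  haveI : Fact p.Prime := ⟨hp⟩
  haveI : CharP K p := charP_of_injective_algebraMap (algebraMap k K).injective p
  obtain ⟨t, rfl⟩ := hAfg
  haveI := hfrac
  -- Step 1: `{g₀}` is `p`-independent
  have hg₀cl : g₀ ∉ Subring.closure (Set.range (frobenius K p) ∪ (∅ : Set K)) := by
    rw [Set.union_empty, ← RingHom.coe_range, Subring.closure_eq]
    intro h
    obtain ⟨c, hc⟩ := RingHom.mem_range.mp h
    exact hg c (by rw [← frobenius_def]; exact hc)
  have hB₀ind := pIndep_insert p ∅ (pIndep_empty p) hg₀cl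
  -- Step 2: `B₁ ⊇ {g₀}` maximal `p`-independent inside `{g₀} ∪ k'`
  obtain ⟨B₁, hB₀B₁, hB₁Y, hB₁ind, hYB₁⟩ :=
    exists_maximal_pIndep p (insert g₀ (Set.range (algebraMap k K))) (insert g₀ ∅)
      (Set.insert_subset_insert (Set.empty_subset _)) hB₀ind
  have hg₀B₁ : g₀ ∈ B₁ := hB₀B₁ (Set.mem_insert _ _)
  -- Step 3: a `p`-basis `Γ ⊇ B₁` and the dual derivation at `g₀`
  obtain ⟨Γ, hB₁Γ, -, hΓind, hΓgen⟩ := exists_maximal_pIndep p Set.univ B₁ (Set.subset_univ _) hB₁ind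
  have hΓ : IsPBasisOver p (frobenius K p).range Γ := isPBasisOver_of_pIndep_of_univ_subset p hΓind hΓgen
  have hg₀Γ : g₀ ∈ Γ := hB₁Γ hg₀B₁
  obtain ⟨D, hDg₀, hDΓ⟩ := IsPBasisOver.exists_dual_derivation hΓ ⟨g₀, hg₀Γ⟩
  -- Step 4: `D` kills `B₁' = B₁ ∖ {g₀}` and `L₀ = K^p[B₁']`
  set B₁' : Set K := B₁ \ {g₀} with hB₁'
  have hDB₁' : ∀ b ∈ B₁', D b = 0 := by
    rintro b ⟨hb, hbg⟩
    exact hDΓ ⟨b, hB₁Γ hb⟩ fun h => hbg (congrArg Subtype.val h)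
  have hDL₀ : ∀ x ∈ Subring.closure (Set.range (frobenius K p) ∪ B₁'), D x = 0 := fun x hx =>
    derivation_eq_zero_of_mem_closure p D hDB₁' hx
  have hB₁'k' : B₁' ⊆ Set.range (algebraMap k K) := by
    rintro b ⟨hb, hbg⟩
    rcases hB₁Y hb with h | h
    · exact absurd h hbg
    · exact h
  -- the subfields `L₀ = K^p(B₁')`, `k' = im k`, `k₂ = k' ∩ L₀`
  let L₀ : Subfield K := Subfield.closure (Set.range (frobenius K p) ∪ B₁')
  have hL₀mem : ∀ z, z ∈ L₀ ↔ z ∈ Subring.closure (Set.range (frobenius K p) ∪ B₁') :=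
    fun z => mem_subfieldClosure_iff p _ Set.subset_union_left z
  let kf : Subfield K := (algebraMap k K).fieldRange
  let k₂ : Subfield K := kf ⊓ L₀
  have hk₂A : ∀ z ∈ k₂, z ∈ Algebra.adjoin k (↑t : Set K) := by
    intro z hz
    obtain ⟨c, rfl⟩ := RingHom.mem_fieldRange.mp (Subfield.mem_inf.mp hz).1
    exact Subalgebra.algebraMap_mem _ c
  have hk₂D : ∀ z ∈ k₂, D z = 0 := fun z hz =>
    hDL₀ z ((hL₀mem z).mp (Subfield.mem_inf.mp hz).2)
  -- Step 5: the finiteness input, applied to `k₂ ≤ k' ≤ k₂(x^p, g₀)`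
  let w : Finset K := insert g₀ (t.image fun x => x ^ p)
  have hFM : k₂ ≤ kf := inf_le_left
  have hpow : ∀ x ∈ kf, x ^ p ∈ k₂ := fun x hx =>
    Subfield.mem_inf.mpr ⟨pow_mem hx p, (hL₀mem _).mpr (Subring.subset_closure (Or.inl ⟨x, frobenius_def ..⟩))⟩
  have hMN : (kf : Set K) ⊆ (Subfield.closure ((k₂ : Set K) ∪ ↑w) : Set K) := by
    -- (a) `p`-th powers of elements of `A`, hence of `K = Frac A`, lie in `N = k₂(w)`
    have hA_N : ∀ z ∈ Algebra.adjoin k (↑t : Set K), z ^ p ∈ Subfield.closure ((k₂ : Set K) ∪ ↑w) := by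
      intro z hz
      rw [Algebra.mem_adjoin_iff] at hz
      have hle : Subring.closure (Set.range (algebraMap k K) ∪ ↑t) ≤
          ((Subfield.closure ((k₂ : Set K) ∪ ↑w)).comap (frobenius K p)).toSubring := by
        rw [Subring.closure_le]
        rintro x (⟨c, rfl⟩ | hx)
        · show frobenius K p (algebraMap k K c) ∈ Subfield.closure ((k₂ : Set K) ∪ ↑w)
          rw [frobenius_def]
          exact Subfield.subset_closure (Or.inl (hpow _ (RingHom.mem_fieldRange.mpr ⟨c, rfl⟩)))
        · show frobenius K p x ∈ Subfield.closure ((k₂ : Set K) ∪ ↑w)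
          rw [frobenius_def]
          exact Subfield.subset_closure (Or.inr (Finset.mem_coe.mpr
            (Finset.mem_insert_of_mem (Finset.mem_image_of_mem _ (Finset.mem_coe.mp hx)))))
      have := hle hz
      rw [Subfield.mem_toSubring, Subfield.mem_comap, frobenius_def] at this
      exact this
    have hK_N : ∀ c : K, c ^ p ∈ Subfield.closure ((k₂ : Set K) ∪ ↑w) := by
      intro c
      obtain ⟨x, y, -, hxy⟩ := IsFractionRing.div_surjective (A := Algebra.adjoin k (↑t : Set K)) c
      rw [← hxy]
      change ((x : K) / (y : K)) ^ p ∈ _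
      rw [div_pow]
      exact div_mem (hA_N x x.2) (hA_N y y.2)
    -- (b) `k' ⊆ K^p[B₁] ⊆ N`
    intro z hz
    obtain ⟨c, rfl⟩ := RingHom.mem_fieldRange.mp hz
    have h1 : algebraMap k K c ∈ Subring.closure (Set.range (frobenius K p) ∪ B₁) :=
      hYB₁ (Set.mem_insert_of_mem _ ⟨c, rfl⟩)
    have hle : Subring.closure (Set.range (frobenius K p) ∪ B₁) ≤
        (Subfield.closure ((k₂ : Set K) ∪ ↑w)).toSubring := by
      rw [Subring.closure_le]
      rintro x (⟨y, rfl⟩ | hx)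
      · show frobenius K p y ∈ Subfield.closure ((k₂ : Set K) ∪ ↑w)
        rw [frobenius_def]
        exact hK_N y
      · show x ∈ Subfield.closure ((k₂ : Set K) ∪ ↑w)
        by_cases hxg : x = g₀
        · rw [hxg]
          exact Subfield.subset_closure (Or.inr (Finset.mem_coe.mpr (Finset.mem_insert_self g₀ _)))
        · have hx' : x ∈ B₁' := ⟨hx, hxg⟩
          exact Subfield.subset_closure (Or.inl (Subfield.mem_inf.mpr
            ⟨RingHom.mem_fieldRange.mpr (hB₁'k' hx'), (hL₀mem _).mpr (Subring.subset_closure (Or.inr hx'))⟩))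
    exact hle h1
  obtain ⟨f, μ, hμ⟩ := hF K k₂ kf w hFM hpow hMN
  -- Step 6: denominators
  have hfr := fun x : K => IsFractionRing.div_surjective (A := Algebra.adjoin k (↑t : Set K)) (D x)
  choose a b hb hab using hfr
  have hb0 : ∀ x, ((b x : Algebra.adjoin k (↑t : Set K)) : K) ≠ 0 := fun x h =>
    nonZeroDivisors.ne_zero (hb x) (Subtype.ext h)
  have hDx : ∀ x, D x = ((a x : Algebra.adjoin k (↑t : Set K)) : K) / ((b x : Algebra.adjoin k (↑t : Set K)) : K) :=
    fun x => (hab x).symm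
  set s : K := (∏ x ∈ t, ((b x : Algebra.adjoin k (↑t : Set K)) : K)) *
    ∏ j : Fin f, ((b (μ j) : Algebra.adjoin k (↑t : Set K)) : K) with hs
  have hs0 : s ≠ 0 := mul_ne_zero (Finset.prod_ne_zero_iff.mpr fun x _ => hb0 x)
    (Finset.prod_ne_zero_iff.mpr fun j _ => hb0 (μ j))
  -- `s * D z ∈ A` as soon as `s = r * den(D z)` with `r ∈ A`
  have hkey : ∀ (z r : K), r ∈ Algebra.adjoin k (↑t : Set K) →
      s = r * ((b z : Algebra.adjoin k (↑t : Set K)) : K) → s * D z ∈ Algebra.adjoin k (↑t : Set K) := by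
    intro z r hr hsr
    rw [hsr, hDx z, mul_assoc, mul_div_assoc', mul_div_cancel_left₀ _ (hb0 z)]
    exact Subalgebra.mul_mem _ hr (a z).2
  have hst : ∀ x ∈ t, s * D x ∈ Algebra.adjoin k (↑t : Set K) := by
    intro x hx
    refine hkey x ((∏ z ∈ t.erase x, ((b z : Algebra.adjoin k (↑t : Set K)) : K)) *
      ∏ j : Fin f, ((b (μ j) : Algebra.adjoin k (↑t : Set K)) : K)) ?_ ?_
    · exact Subalgebra.mul_mem _ (Subalgebra.prod_mem _ fun z _ => (b z).2)
        (Subalgebra.prod_mem _ fun j _ => (b (μ j)).2)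
    · rw [hs, ← Finset.mul_prod_erase t (fun x => ((b x : Algebra.adjoin k (↑t : Set K)) : K)) hx]
      ring
  have hsμ : ∀ j, s * D (μ j) ∈ Algebra.adjoin k (↑t : Set K) := by
    intro j
    refine hkey (μ j) ((∏ x ∈ t, ((b x : Algebra.adjoin k (↑t : Set K)) : K)) *
      ∏ j' ∈ Finset.univ.erase j, ((b (μ j') : Algebra.adjoin k (↑t : Set K)) : K)) ?_ ?_
    · exact Subalgebra.mul_mem _ (Subalgebra.prod_mem _ fun z _ => (b z).2)
        (Subalgebra.prod_mem _ fun j' _ => (b (μ j')).2)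
    · rw [hs, ← Finset.mul_prod_erase Finset.univ
        (fun j' => ((b (μ j') : Algebra.adjoin k (↑t : Set K)) : K)) (Finset.mem_univ j)]
      ring
  -- `D` on the constants: `D(Σ a_j μ_j) = Σ a_j D μ_j`
  have hsk : ∀ c : k, s * D (algebraMap k K c) ∈ Algebra.adjoin k (↑t : Set K) := by
    intro c
    obtain ⟨a', ha', hc⟩ := hμ (algebraMap k K c) (RingHom.mem_fieldRange.mpr ⟨c, rfl⟩)
    rw [hc, map_sum, Finset.mul_sum]
    refine Subalgebra.sum_mem _ fun j _ => ?_
    rw [D.leibniz, hk₂D _ (ha' j), smul_zero, add_zero, smul_eq_mul, mul_left_comm]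
    exact Subalgebra.mul_mem _ (hk₂A _ (ha' j)) (hsμ j)
  refine ⟨D, s, hs0, fun y hy => ?_, ?_⟩
  · induction hy using Algebra.adjoin_induction with
    | mem x hx => exact hst x (Finset.mem_coe.mp hx)
    | algebraMap c => exact hsk c
    | add x y _ _ hx' hy' =>
      rw [map_add, mul_add]
      exact Subalgebra.add_mem _ hx' hy'
    | mul x y hx hy hx' hy' =>
      have h1 : s * D (x * y) = x * (s * D y) + y * (s * D x) := by
        rw [D.leibniz, smul_eq_mul, smul_eq_mul]
        ring
      rw [h1]
      exact Subalgebra.add_mem _ (Subalgebra.mul_mem _ hx hy') (Subalgebra.mul_mem _ hy hx')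
  · rw [hDg₀]
    exact one_ne_zero

/-- **LEMMA F₀ holds** (for prime `p`). [folklore] -/
theorem heightOneIntermediateFinite (p : ℕ) (hp : p.Prime) : HeightOneIntermediateFinite p :=
  LemmaF0.heightOneIntermediateFinite p hp

/-- **LEMMA D-abs, UNCONDITIONAL** (rev 2). [folklore] -/
theorem absDerivation_of_forall_pow_ne' (p : ℕ) (hp : p.Prime)
    (k : Type) [Field k] [CharP k p] (K : Type) [Field K] [Algebra k K] (A : Subalgebra k K)
    (hAfg : A.FG) (hfrac : IsFractionRing A K) (g₀ : K) (hg : ∀ c : K, c ^ p ≠ g₀) :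
    ∃ (D : Derivation ℤ K K) (s : K), s ≠ 0 ∧ (∀ y : K, y ∈ A → s * D y ∈ A) ∧ D g₀ ≠ 0 :=
  absDerivation_of_forall_pow_ne p hp (heightOneIntermediateFinite p hp) k K A hAfg hfrac g₀ hg

/-- Verbatim copy of the census target `Census_lens5_arcPotential.lean : CpSibling.ArcPotential.AbsDerivationMovesAt`
(crux workfiles are not importable from one another on the farm). -/
def AbsDerivationMovesAt (p : ℕ) : Prop :=
  ∀ (k : Type) [Field k] [CharP k p] (K : Type) [Field K] [Algebra k K] (A : Subalgebra k K), A.FG → IsFractionRing A K →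
    ∀ g₀ : K, (∀ c : K, c ^ p ≠ g₀) →
    ∃ (D : Derivation ℤ K K) (s : K), s ≠ 0 ∧ (∀ y : K, y ∈ A → s * D y ∈ A) ∧ D g₀ ≠ 0

/-- **The census target `AbsDerivationMovesAt p` HOLDS for every prime `p`** — the `hD` input of the census certificates
`derivationStub_of_absDerivation`, `arcConstants_of_absDerivation`, `arcInfinite_of_potential_of_absDerivation`,
`arcConstants_of_potential_of_absDerivation`, `cleanLU3DefectDiscrete_of_potential_of_absDerivation`. [folklore] -/
theorem absDerivationMovesAt_holds {p : ℕ} (hp : p.Prime) : AbsDerivationMovesAt p :=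
  fun k _ _ K _ _ A hAfg hfrac g₀ hg => absDerivation_of_forall_pow_ne' p hp k K A hAfg hfrac g₀ hg

/-- **The lead's stub `stub_cleanLU3DefectArcConstants` (Sketch rev 20 l.232), statement verbatim, PROVED**: class (A), finite residue
tower, `g₀ ∈ k K^p ∖ K^p` — via LEMMA D-abs (unconditional) and the landed ✓ `cleanLU3Defect_of_discrete_of_finiteResidue`. [folklore] -/
theorem cleanLU3DefectArcConstants :
    ∀ (p : ℕ), p.Prime →
    ∀ (k : Type) [Field k] [CharP k p] (K : Type) [Field K] [Algebra k K]
    (O : ValuationSubring K) (A : Subalgebra k K), A.toSubring ≤ O.toSubring → A.FG → IsFractionRing A K →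
    ringKrullDim A ≤ 3 → IsRegularLocalRing (locAtCentre A.toSubring O) →
    ringKrullDim (locAtCentre A.toSubring O) = 3 →
    (∀ (T : Subring K) (hT : T ≤ O.toSubring), A.toSubring ≤ T → (subringCentre T O hT).IsMaximal) →
    ∀ g₀ : K, (∀ c : K, c ^ p ≠ g₀) →
    (∀ f₀ : K, ∃ f₁ : K, O.valuation (g₀ - f₁ ^ p) < O.valuation (g₀ - f₀ ^ p)) →
    (∀ hk : ∀ c : k, algebraMap k K c ∈ O, transcendenceDefect k O hk ≠ 0) →
    (∃ π : K, π ≠ 0 ∧ (∀ x : K, O.valuation x < 1 → O.valuation x ≤ O.valuation π) ∧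
      (∀ x : K, x ≠ 0 → ∃ n : ℕ, O.valuation π ^ n ≤ O.valuation x)) →
    (∃ S : Finset K, (↑S : Set K) ⊆ O ∧
      ∀ y : K, y ∈ O → ∃ r : K, r ∈ Subring.closure ((locAtCentre A.toSubring O : Set K) ∪ ↑S) ∧ O.valuation (y - r) < 1) →
    g₀ ∈ Algebra.adjoin k (Set.range fun y : K => y ^ p) →
    ∃ (A' : Subalgebra k K), A'.toSubring ≤ O.toSubring ∧ A ≤ A' ∧ A'.FG ∧
    ∃ (_ : IsRegularLocalRing (locAtCentre A'.toSubring O)) (c : Fin p → K), (∃ j : Fin p, (j : ℕ) ≠ 0 ∧ c j ≠ 0) ∧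
    ((∃ (d m : ℕ) (hmd : m ≤ d) (t : Fin d → ↥(locAtCentre A'.toSubring O)) (a : Fin m → ℕ) (u : ↥(locAtCentre A'.toSubring O)), IsUnit u ∧
    Ideal.span (Set.range t) = IsLocalRing.maximalIdeal ↥(locAtCentre A'.toSubring O) ∧
    ringKrullDim ↥(locAtCentre A'.toSubring O) = (d : WithBot ℕ∞) ∧ 0 < m ∧ (∀ i, ¬ p ∣ a i) ∧
    (∑ j : Fin p, c j ^ p * g₀ ^ (j : ℕ)) = (u : K) * ∏ i : Fin m, ((t (Fin.castLE hmd i) : ↥(locAtCentre A'.toSubring O)) : K) ^ (a i)) ∨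
    (∃ u : ↥(locAtCentre A'.toSubring O), IsUnit u ∧ (∑ j : Fin p, c j ^ p * g₀ ^ (j : ℕ)) = (u : K) ∧
    ∀ c' : ↥(locAtCentre A'.toSubring O), u - c' ^ p ∉ IsLocalRing.maximalIdeal ↥(locAtCentre A'.toSubring O)) ∨
    (∃ s c' : ↥(locAtCentre A'.toSubring O), (∑ j : Fin p, c j ^ p * g₀ ^ (j : ℕ)) = (s : K) ∧
    s - c' ^ p ∈ IsLocalRing.maximalIdeal ↥(locAtCentre A'.toSubring O) ∧
    s - c' ^ p ∉ IsLocalRing.maximalIdeal ↥(locAtCentre A'.toSubring O) ^ 2)) := by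
  intro p hp k _ _ K _ _ O A hAO hAfg hfrac hdimA hreg hdim3 hzd g₀ hg₀ hdefect htd hdisc hres _
  exact Summit.ResolutionOfSingularities.ResolutionOfSingularities.Theorems.RadicialJung.CleanModels.cleanLU3Defect_of_discrete_of_finiteResidue
    p hp k K O A hAO hAfg hfrac hdimA hreg hdim3 hzd g₀ hg₀ hdefect htd hdisc hres
    (absDerivation_of_forall_pow_ne' p hp k K A hAfg hfrac g₀ hg₀)

end Summit.ResolutionOfSingularities.ResolutionOfSingularities.Cruxes.DescentPerfectToAll.CpSibling.AbsDerivation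

end

-- ════════ PART 3: Lens5_ArcPotential.lean (66960002e3bd) ════════
noncomputable section

set_option linter.dupNamespace false
set_option linter.unusedSectionVars false

open IsLocalRing
open Literature.AlgebraicGeometry.Resolution
open Summit.ResolutionOfSingularities.ResolutionOfSingularities.Theorems.RadicialJung.CleanModels

namespace Summit.ResolutionOfSingularities.ResolutionOfSingularities.Cruxes.DescentPerfectToAll.CpSibling.ArcPotentialProof

variable {K : Type} [Field K]

/-! ## Bricks (P0)–(P2) (verbatim from `Census_lens5_arcPotentialCore.lean` ad493c466fcd; crux workfiles do not import one another) -/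

section Bricks

theorem exists_derivation_pow_mul (D : Derivation ℤ K K) {R : Subring K} (hD : ∀ y ∈ R, D y ∈ R)
    {π : K} (hDπ : ∃ ε ∈ R, D π = π * ε) {F : K} (hF : F ∈ R) (a : ℕ) :
    ∃ Φ ∈ R, D (π ^ a * F) = π ^ a * Φ := by
  obtain ⟨ε, hε, hDπ⟩ := hDπ
  induction a with
  | zero => exact ⟨D F, hD F hF, by simp⟩
  | succ n ih =>
    obtain ⟨Φ, hΦ, hn⟩ := ih
    refine ⟨Φ + F * ε, R.add_mem hΦ (R.mul_mem hF hε), ?_⟩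
    have h1 : π ^ (n + 1) * F = π * (π ^ n * F) := by ring
    rw [h1, Derivation.leibniz, smul_eq_mul, smul_eq_mul, hn, hDπ]
    ring

/-- (P1) Jacobian bound. [folklore] -/
theorem jacobian_bound (D : Derivation ℤ K K) {R : Subring K} (hD : ∀ y ∈ R, D y ∈ R)
    {π : K} (hπR : π ∈ R) (hπ0 : π ≠ 0) (hDπ : ∃ ε ∈ R, D π = π * ε)
    {F u : K} (hF : F ∈ R) (hu : ∀ G ∈ R, u ≠ π * G) {a e : ℕ}
    (h : D (π ^ a * F) = π ^ e * u) : a ≤ e := by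
  by_contra hle
  have hlt : e < a := not_le.mp hle
  obtain ⟨Φ, hΦ, hΦeq⟩ := exists_derivation_pow_mul D hD hDπ hF a
  obtain ⟨d, hd⟩ := Nat.exists_eq_add_of_lt hlt
  apply hu (π ^ d * Φ) (R.mul_mem (R.pow_mem hπR d) hΦ)
  have h1 : π ^ e * u = π ^ e * (π * (π ^ d * Φ)) := by
    rw [← h, hΦeq, hd]; ring
  exact mul_left_cancel₀ (pow_ne_zero e hπ0) h1

theorem jacobian_bound_of_isUnit (D : Derivation ℤ K K) {R : Subring K} [IsLocalRing R] (hD : ∀ y ∈ R, D y ∈ R)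
    {π : K} (hπR : π ∈ R) (hπ0 : π ≠ 0) (hπm : (⟨π, hπR⟩ : R) ∈ maximalIdeal R) (hDπ : ∃ ε ∈ R, D π = π * ε)
    {F u : K} (hF : F ∈ R) (huR : u ∈ R) (hunit : IsUnit (⟨u, huR⟩ : R)) {a e : ℕ}
    (h : D (π ^ a * F) = π ^ e * u) : a ≤ e := by
  refine jacobian_bound D hD hπR hπ0 hDπ hF (fun G hG hG' => ?_) h
  have hmem : (⟨u, huR⟩ : R) ∈ maximalIdeal R := by
    have h1 : (⟨u, huR⟩ : R) = ⟨G, hG⟩ * ⟨π, hπR⟩ :=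
      Subtype.ext (by change u = G * π; rw [hG', mul_comm])
    rw [h1]
    exact (maximalIdeal R).mul_mem_left _ hπm
  exact (IsLocalRing.mem_maximalIdeal _).mp hmem hunit

variable {O : ValuationSubring K}

theorem valuation_le_sq_of_mem_sq' {R : Subring K} [IsLocalRing R] (hdom : SubringDominates R O.toSubring)
    {π : K} (hπ : ∀ x : K, O.valuation x < 1 → O.valuation x ≤ O.valuation π)
    (y : R) (hy : y ∈ maximalIdeal R ^ 2) : O.valuation (y : K) ≤ O.valuation π ^ 2 := by
  have hmem : ∀ a : R, a ∈ maximalIdeal R ↔ O.valuation (a : K) < 1 :=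
    (subringDominates_valuationSubring_iff hdom.1).mp hdom
  rw [pow_two] at hy
  refine Submodule.mul_induction_on hy (fun a ha b hb => ?_) (fun a b ha hb => ?_)
  · rw [Subring.coe_mul, map_mul, pow_two]
    exact mul_le_mul' (hπ _ ((hmem a).mp ha)) (hπ _ ((hmem b).mp hb))
  · rw [Subring.coe_add]
    exact Valuation.map_add_le _ ha hb

theorem valuation_lt_one_of_mul_le_sq {π x : K} (hπ0 : π ≠ 0) (hvπ1 : O.valuation π < 1)
    (hx : O.valuation (x * π) ≤ O.valuation π ^ 2) : O.valuation x < 1 := by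
  have hvπ0 : 0 < O.valuation π := zero_lt_iff.mpr ((Valuation.ne_zero_iff _).mpr hπ0)
  rw [map_mul, pow_two, mul_comm] at hx
  exact lt_of_le_of_lt (le_of_mul_le_mul_left hx hvπ0) hvπ1

theorem sub_mul_not_mem_sq {R : Subring K} [IsLocalRing R] (hdom : SubringDominates R O.toSubring)
    {π : K} (hπR : π ∈ R) (hπ0 : π ≠ 0) (hπm : (⟨π, hπR⟩ : R) ∈ maximalIdeal R)
    (hπ : ∀ x : K, O.valuation x < 1 → O.valuation x ≤ O.valuation π)
    (F : R) (hF2 : F ∉ maximalIdeal R ^ 2) (hvF : O.valuation (F : K) ≤ O.valuation π ^ 2) (l : R) :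
    F - l * ⟨π, hπR⟩ ∉ maximalIdeal R ^ 2 := by
  have hmem : ∀ a : R, a ∈ maximalIdeal R ↔ O.valuation (a : K) < 1 :=
    (subringDominates_valuationSubring_iff hdom.1).mp hdom
  intro hq
  have hvq := valuation_le_sq_of_mem_sq' hdom hπ _ hq
  have hvlπ : O.valuation ((l : K) * π) ≤ O.valuation π ^ 2 := by
    have h1 : (l : K) * π = (F : K) - ((F - l * ⟨π, hπR⟩ : R) : K) := by
      push_cast
      ring
    rw [h1]
    exact Valuation.map_sub_le _ hvF hvq
  have hvπ1 : O.valuation π < 1 := (hmem ⟨π, hπR⟩).mp hπm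
  have hlm : l ∈ maximalIdeal R := (hmem l).mpr (valuation_lt_one_of_mul_le_sq hπ0 hvπ1 hvlπ)
  apply hF2
  have h2 : F = (F - l * ⟨π, hπR⟩) + l * ⟨π, hπR⟩ := by ring
  rw [h2]
  exact (maximalIdeal R ^ 2).add_mem hq (by rw [pow_two]; exact Ideal.mul_mem_mul hlm hπm)

/-- (P2) independence of `π`, `F` modulo `𝔪²`. [folklore] -/
theorem indep_of_valuation {R : Subring K} [IsLocalRing R] (hdom : SubringDominates R O.toSubring)
    {π : K} (hπR : π ∈ R) (hπ0 : π ≠ 0) (hπm : (⟨π, hπR⟩ : R) ∈ maximalIdeal R)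
    (hπ : ∀ x : K, O.valuation x < 1 → O.valuation x ≤ O.valuation π)
    (F : R) (hFm : F ∈ maximalIdeal R) (hF2 : F ∉ maximalIdeal R ^ 2) (hvF : O.valuation (F : K) ≤ O.valuation π ^ 2)
    (a b : R) (hab : a * ⟨π, hπR⟩ + b * F ∈ maximalIdeal R ^ 2) : a ∈ maximalIdeal R ∧ b ∈ maximalIdeal R := by
  have hmem : ∀ a : R, a ∈ maximalIdeal R ↔ O.valuation (a : K) < 1 :=
    (subringDominates_valuationSubring_iff hdom.1).mp hdom
  have hb : b ∈ maximalIdeal R := by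
    by_contra hbu
    have hbunit : IsUnit b := by
      rwa [IsLocalRing.mem_maximalIdeal, mem_nonunits_iff, not_not] at hbu
    obtain ⟨w, hw⟩ := hbunit.exists_left_inv
    have h1 : F - (-(w * a)) * ⟨π, hπR⟩ ∈ maximalIdeal R ^ 2 := by
      have h2 : F - (-(w * a)) * ⟨π, hπR⟩ = w * (a * ⟨π, hπR⟩ + b * F) := by
        have h3 : w * (a * ⟨π, hπR⟩ + b * F) = w * a * ⟨π, hπR⟩ + (w * b) * F := by ring
        rw [h3, hw]; ring
      rw [h2]
      exact (maximalIdeal R ^ 2).mul_mem_left _ hab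
    exact sub_mul_not_mem_sq hdom hπR hπ0 hπm hπ F hF2 hvF _ h1
  refine ⟨?_, hb⟩
  have haπ : a * ⟨π, hπR⟩ ∈ maximalIdeal R ^ 2 := by
    have h1 : a * ⟨π, hπR⟩ = (a * ⟨π, hπR⟩ + b * F) - b * F := by ring
    rw [h1]
    exact (maximalIdeal R ^ 2).sub_mem hab (by rw [pow_two]; exact Ideal.mul_mem_mul hb hFm)
  have hv := valuation_le_sq_of_mem_sq' hdom hπ _ haπ
  rw [Subring.coe_mul] at hv
  have hvπ1 : O.valuation π < 1 := (hmem ⟨π, hπR⟩).mp hπm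
  exact (hmem a).mpr (valuation_lt_one_of_mul_le_sq hπ0 hvπ1 hv)

/-- (P0). [folklore] -/
theorem valuation_sub_pow_eq_pow_mul {p : ℕ} [Fact p.Prime] [CharP K p] (O : ValuationSubring K) (π : K) (hπ0 : π ≠ 0)
    (hvπ1 : O.valuation π < 1)
    (hπ : ∀ x : K, O.valuation x < 1 → O.valuation x ≤ O.valuation π)
    (harch : ∀ x : K, x ≠ 0 → ∃ n : ℕ, O.valuation π ^ n ≤ O.valuation x)
    (h : K) (hh : h ∈ O) (hnp : ∀ c : K, c ^ p ≠ h)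
    (hdefect : ∀ c : K, ∃ c' : K, O.valuation (h - c' ^ p) < O.valuation (h - c ^ p))
    (c : K) (hc : c ∈ O) : ∃ j : ℕ, O.valuation (h - c ^ p) = O.valuation π ^ (p * j) := by
  have hvπ0 : 0 < O.valuation π := zero_lt_iff.mpr ((Valuation.ne_zero_iff _).mpr hπ0)
  have hinj : Function.Injective (fun n : ℕ => O.valuation π ^ n) := (pow_right_strictAnti₀ hvπ0 hvπ1).injective
  have hf0 : h - c ^ p ≠ 0 := sub_ne_zero.mpr (Ne.symm (hnp c))
  have hfO : h - c ^ p ∈ O := O.sub_mem hh (O.pow_mem hc p)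
  obtain ⟨n, hn⟩ :=
    Summit.ResolutionOfSingularities.ResolutionOfSingularities.Theorems.RadicialJung.CleanModels.exists_valuation_eq_pow_of_discrete
      O π hπ harch (h - c ^ p) hf0 hfO
  by_cases hpn : p ∣ n
  · obtain ⟨j, rfl⟩ := hpn
    exact ⟨j, hn⟩
  exfalso
  obtain ⟨c', hc'⟩ := hdefect c
  -- `c' ∈ O`: otherwise `v(h − c'^p) = v(c'^p) > 1 ≥ v(h − c^p)`
  have hle1 : O.valuation (h - c ^ p) ≤ 1 := (O.valuation_le_one_iff _).mpr hfO
  have hc'O : c' ∈ O := by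
    by_contra hc'O
    have hvc' : 1 < O.valuation c' := by
      rw [← not_le, O.valuation_le_one_iff]; exact hc'O
    have hvc'p : 1 < O.valuation (c' ^ p) := by
      rw [map_pow]; exact one_lt_pow₀ hvc' (Fact.out : p.Prime).ne_zero
    have hvh : O.valuation h < O.valuation (c' ^ p) := lt_of_le_of_lt ((O.valuation_le_one_iff _).mpr hh) hvc'p
    have heq : O.valuation (h - c' ^ p) = O.valuation (c' ^ p) := Valuation.map_sub_eq_of_lt_right _ hvh
    have : O.valuation (h - c' ^ p) ≤ 1 := (hc'.le.trans hle1)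
    rw [heq] at this
    exact absurd hvc'p (not_lt.mpr this)
  -- `d := c^p − c'^p = (h − c'^p) − (h − c^p)` has value `v(h − c^p) = v(π)^n`
  have hd : O.valuation (c ^ p - c' ^ p) = O.valuation π ^ n := by
    have h1 : c ^ p - c' ^ p = (h - c' ^ p) - (h - c ^ p) := by ring
    rw [h1, Valuation.map_sub_eq_of_lt_right _ hc', hn]
  -- and is `(c − c')^p`
  have hd' : c ^ p - c' ^ p = (c - c') ^ p := (sub_pow_char c c').symm
  have hcc0 : c - c' ≠ 0 := by
    intro h0
    have : O.valuation (c ^ p - c' ^ p) = 0 := by rw [hd', h0, zero_pow (Fact.out : p.Prime).ne_zero, map_zero]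
    rw [hd] at this
    exact (pow_ne_zero n hvπ0.ne') this
  obtain ⟨j, hj⟩ :=
    Summit.ResolutionOfSingularities.ResolutionOfSingularities.Theorems.RadicialJung.CleanModels.exists_valuation_eq_pow_of_discrete
      O π hπ harch (c - c') hcc0 (O.sub_mem hc hc'O)
  have hpow : O.valuation π ^ n = O.valuation π ^ (p * j) := by
    rw [← hd, hd', map_pow, hj, ← pow_mul, mul_comm]
  exact hpn ⟨j, hinj hpow⟩

end Bricks


/-! ## Regular system of parameters bookkeeping in dimension 3 -/

section RSP

variable {S : Type*} [CommRing S] [IsLocalRing S]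

/-- A regular local ring of dimension `3` has `𝔪 = (x₀, x₁, x₂)`. [folklore] -/
theorem exists_span_triple [IsNoetherianRing S] (hreg : IsRegularLocalRing S) (hdim : ringKrullDim S = 3) :
    ∃ x₀ x₁ x₂ : S, maximalIdeal S = Ideal.span {x₀, x₁, x₂} := by
  haveI := hreg
  obtain ⟨x, hx⟩ := exists_regularSystemOfParameters (R := S)
  have hsf : (maximalIdeal S).spanFinrank = 3 := by
    have e := IsRegularLocalRing.spanFinrank_maximalIdeal (R := S)
    rw [hdim] at e; exact_mod_cast e
  let x' : Fin 3 → S := fun j => x (Fin.cast hsf.symm j)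
  refine ⟨x' 0, x' 1, x' 2, ?_⟩
  rw [← hx]
  have hr : Set.range x = Set.range x' := by
    ext t
    simp only [Set.mem_range, x']
    constructor
    · rintro ⟨i, rfl⟩; exact ⟨Fin.cast hsf i, by simp⟩
    · rintro ⟨j, rfl⟩; exact ⟨Fin.cast hsf.symm j, rfl⟩
  rw [hr]
  congr 1
  ext t
  simp only [Set.mem_range, Set.mem_insert_iff, Set.mem_singleton_iff]
  constructor
  · rintro ⟨i, rfl⟩; fin_cases i <;> simp
  · rintro (rfl | rfl | rfl)
    exacts [⟨0, rfl⟩, ⟨1, rfl⟩, ⟨2, rfl⟩]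

/-- If `𝔪 = (x₀, x₁, x₂)`, `π ∈ 𝔪 ∖ 𝔪²`, `F ∈ 𝔪`, and `π`, `F` are independent modulo `𝔪²` (`a π + b F ∈ 𝔪² ⇒ b ∈ 𝔪`), then
`𝔪 = (π, F, t₃)` for some `t₃`. [folklore] -/
theorem exists_span_triple_of_indep (x₀ x₁ x₂ π F : S)
    (hm : maximalIdeal S = Ideal.span {x₀, x₁, x₂}) (hπ : π ∈ maximalIdeal S) (hπ2 : π ∉ maximalIdeal S ^ 2)
    (hF : F ∈ maximalIdeal S) (hind : ∀ a b : S, a * π + b * F ∈ maximalIdeal S ^ 2 → b ∈ maximalIdeal S) :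
    ∃ t₃ : S, maximalIdeal S = Ideal.span {π, F, t₃} := by
  obtain ⟨y, z, hy, hz, hmyz⟩ := exists_span_triple_of_not_mem_sq x₀ x₁ x₂ π hm hπ hπ2
  have hF' : F ∈ Ideal.span ({π, y, z} : Set S) := hmyz ▸ hF
  obtain ⟨a₀, a₁, a₂, hFeq⟩ := (mem_span_triple_iff π y z F).mp hF'
  have perm : ∀ a b c : S, (Ideal.span {a, b, c} : Ideal S) = Ideal.span {b, a, c} := by
    intro a b c
    rw [Set.insert_comm]
  have perm' : ∀ a b c : S, (Ideal.span {a, b, c} : Ideal S) = Ideal.span {c, a, b} := by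
    intro a b c
    congr 1
    ext t
    simp only [Set.mem_insert_iff, Set.mem_singleton_iff]
    tauto
  by_cases h₁ : IsUnit a₁
  · refine ⟨z, ?_⟩
    have e := span_triple_exchange y π z F a₁ a₀ a₂ (by rw [hmyz, perm]) (by rw [hFeq]; ring) h₁
    rw [e, perm]
  by_cases h₂ : IsUnit a₂
  · refine ⟨y, ?_⟩
    have e := span_triple_exchange z π y F a₂ a₀ a₁ (by rw [hmyz, perm']) (by rw [hFeq]; ring) h₂
    rw [e, perm]
  exfalso
  have hm' : ∀ a : S, ¬ IsUnit a → a ∈ maximalIdeal S := fun a ha => (mem_maximalIdeal _).mpr (mem_nonunits_iff.mpr ha)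
  have hsq : (-a₀) * π + 1 * F ∈ maximalIdeal S ^ 2 := by
    have e : (-a₀) * π + 1 * F = a₁ * y + a₂ * z := by rw [hFeq]; ring
    rw [e, pow_two]
    exact Ideal.add_mem _ (Ideal.mul_mem_mul (hm' _ h₁) hy) (Ideal.mul_mem_mul (hm' _ h₂) hz)
  have h1 : (1 : S) ∈ maximalIdeal S := hind _ _ hsq
  exact (maximalIdeal.isMaximal S).ne_top ((Ideal.eq_top_iff_one _).mpr h1)

end RSP

/-! ## The core: the potential argument along the quadratic sequence -/

section Core

variable {O : ValuationSubring K} {p : ℕ}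


/-- **Transport with factor `π`.**  Along the `π`-charts, if `s • D` preserves `R 0` then `π^N s • D` preserves `R N`. [folklore] -/
theorem derivation_transport_pow {O : ValuationSubring K} (R : ℕ → Subring K) [∀ i, IsLocalRing (R i)]
    (h0 : SubringDominates (R 0) O.toSubring) (hstep : ∀ i, IsQuadraticTransformAlong O (R i) (R (i + 1)))
    (π : K) (hπR : π ∈ R 0) (hπ0 : π ≠ 0) (hvπ : O.valuation π < 1)
    (hπ : ∀ x : K, O.valuation x < 1 → O.valuation x ≤ O.valuation π)
    (D : Derivation ℤ K K) (s : K) (hD : ∀ y ∈ R 0, s * D y ∈ R 0) :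
    ∀ N, ∀ y ∈ R N, π ^ N * s * D y ∈ R N := by
  intro N
  induction N with
  | zero => intro y hy; rw [pow_zero, one_mul]; exact hD y hy
  | succ N ih =>
    obtain ⟨hπN, hRN⟩ := succ_eq_locAtCentre_blowupRing R h0 hstep π hπR hπ0 hvπ hπ N
    let E : Derivation ℤ K K := (π ^ N * s) • D
    have hE : ∀ y, E y = π ^ N * s * D y := fun y => by simp [E, smul_eq_mul]
    have hEN : ∀ y ∈ R N, E y ∈ R N := fun y hy => by rw [hE]; exact ih y hy
    have hB := mul_derivation_mem_blowupRing E hEN hπN hπ0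
    have hL := mul_derivation_mem_locAtCentre E π (B := blowupRing (R N) π) (O := O) hB
    intro y hy
    rw [hRN] at hy
    have := hL y hy
    rw [hE] at this
    rw [hRN]
    have e : π ^ (N + 1) * s * D y = π * (π ^ N * s * D y) := by ring
    rw [e]
    exact this

/-- The data of THEOREM P along the (restarted) quadratic sequence. -/
structure CoreHyp (O : ValuationSubring K) (p : ℕ) (R : ℕ → Subring K) (π : K) (D : Derivation ℤ K K) (s h u : K)
    (e₀ : ℕ) : Prop where
  reg : ∀ i, IsRegularLocalRing (R i)
  dim : ∀ i, ringKrullDim (R i) = 3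
  dom0 : SubringDominates (R 0) O.toSubring
  step : ∀ i, IsQuadraticTransformAlong O (R i) (R (i + 1))
  πR : π ∈ R 0
  π0 : π ≠ 0
  vπ : O.valuation π < 1
  πmax : ∀ x : K, O.valuation x < 1 → O.valuation x ≤ O.valuation π
  arch : ∀ x : K, x ≠ 0 → ∃ n : ℕ, O.valuation π ^ n ≤ O.valuation x
  der : ∀ y ∈ R 0, s * D y ∈ R 0
  hR : h ∈ R 0
  np : ∀ c : K, c ^ p ≠ h
  defect : ∀ c : K, ∃ c' : K, O.valuation (h - c' ^ p) < O.valuation (h - c ^ p)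
  uR : u ∈ R 0
  vu : O.valuation u = 1
  Dh : s * D h = π ^ e₀ * u

/-- The three exits of the algorithm at stage `n` with current approximant `c`: loose clean forms (3), (2), (1). -/
def CoreExit (R : ℕ → Subring K) [∀ i, IsLocalRing (R i)] (p : ℕ) (π h : K) (n : ℕ) (c : K) : Prop :=
  (∃ (m' : ℕ) (G : R n), G ∈ maximalIdeal (R n) ∧ G ∉ maximalIdeal (R n) ^ 2 ∧ (G : K) = (h - c ^ p) / π ^ (p * m')) ∨
  (∃ (m' : ℕ) (U : R n), IsUnit U ∧ (U : K) = (h - c ^ p) / π ^ (p * m') ∧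
    ∀ c' : R n, U - c' ^ p ∉ maximalIdeal (R n)) ∨
  (∃ (m' r : ℕ) (hπn : π ∈ R n) (F t₃ : R n), 0 < r ∧ r < p ∧
    maximalIdeal (R n) = Ideal.span {⟨π, hπn⟩, F, t₃} ∧ (h - c ^ p) / π ^ (p * m') = π ^ r * (F : K))

namespace CoreHyp

variable {R : ℕ → Subring K} [hRloc : ∀ i, IsLocalRing (R i)] {π : K} {D : Derivation ℤ K K} {s h u : K} {e₀ : ℕ}
  (H : CoreHyp O p R π D s h u e₀)
include H

theorem dom (i : ℕ) : SubringDominates (R i) O.toSubring := (sequence_dominates H.dom0 H.step i).1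

theorem mono {i j : ℕ} (hij : i ≤ j) : R i ≤ R j := sequence_monotone H.step hij

theorem le_O (i : ℕ) : R i ≤ O.toSubring := (H.dom i).1

theorem mem_max (i : ℕ) (a : R i) : a ∈ maximalIdeal (R i) ↔ O.valuation (a : K) < 1 :=
  (subringDominates_valuationSubring_iff (H.dom i).1).mp (H.dom i) a

theorem πRi (i : ℕ) : π ∈ R i := H.mono (Nat.zero_le i) H.πR

theorem πmem (i : ℕ) : (⟨π, H.πRi i⟩ : R i) ∈ maximalIdeal (R i) := (H.mem_max i _).mpr H.vπ

theorem πnot2 (i : ℕ) : (⟨π, H.πRi i⟩ : R i) ∉ maximalIdeal (R i) ^ 2 := by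
  intro h2
  have hle := valuation_le_sq_of_mem_sq' (H.dom i) H.πmax _ h2
  change O.valuation π ≤ O.valuation π ^ 2 at hle
  have hvπpos : 0 < O.valuation π := zero_lt_iff.mpr ((Valuation.ne_zero_iff _).mpr H.π0)
  rw [pow_two] at hle
  have : O.valuation π * 1 ≤ O.valuation π * O.valuation π := by rwa [mul_one]
  exact absurd (le_of_mul_le_mul_left this hvπpos) (not_le.mpr H.vπ)

theorem vπpos : 0 < O.valuation π := zero_lt_iff.mpr ((Valuation.ne_zero_iff _).mpr H.π0)

theorem pow_strictAnti : StrictAnti (fun n : ℕ => O.valuation π ^ n) := pow_right_strictAnti₀ H.vπpos H.vπ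

theorem pow_le_pow_iff {a b : ℕ} : O.valuation π ^ a ≤ O.valuation π ^ b ↔ b ≤ a :=
  StrictAnti.le_iff_ge H.pow_strictAnti

theorem pow_lt_pow_iff {a b : ℕ} : O.valuation π ^ a < O.valuation π ^ b ↔ b < a :=
  StrictAnti.lt_iff_gt H.pow_strictAnti

theorem pow_inj {a b : ℕ} (hab : O.valuation π ^ a = O.valuation π ^ b) : a = b :=
  StrictAnti.injective H.pow_strictAnti hab

theorem uRi (i : ℕ) : u ∈ R i := H.mono (Nat.zero_le i) H.uR

theorem u_unit (i : ℕ) : IsUnit (⟨u, H.uRi i⟩ : R i) := isUnit_of_valuation_eq_one R H.dom0 H.step i u (H.uRi i) H.vu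

/-- Stage transport of the derivation: `π^N s • D` preserves `R N`. [folklore] -/
theorem derN : ∀ N, ∀ y ∈ R N, π ^ N * s * D y ∈ R N :=
  derivation_transport_pow R H.dom0 H.step π H.πR H.π0 H.vπ H.πmax D s H.der

theorem derNπ {N : ℕ} (hN : 1 ≤ N) : ∃ ε ∈ R N, π ^ N * s * D π = π * ε := by
  obtain ⟨M, rfl⟩ := Nat.exists_eq_add_of_le hN
  refine ⟨π ^ M * (s * D π), (R (1 + M)).mul_mem ((R (1 + M)).pow_mem (H.πRi _) M) (H.mono (Nat.zero_le _) (H.der π H.πR)), ?_⟩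
  ring

theorem derNh (N : ℕ) : π ^ N * s * D h = π ^ (e₀ + N) * u := by
  rw [mul_assoc, H.Dh]; ring

omit hRloc H in
theorem derivation_pow_p [CharP K p] (D : Derivation ℤ K K) (c : K) : D (c ^ p) = 0 := by
  rw [Derivation.leibniz_pow, nsmul_eq_mul, CharP.cast_eq_zero K p, zero_mul]

variable [hp : Fact p.Prime] [CharP K p]

theorem f_ne (c : K) : h - c ^ p ≠ 0 := sub_ne_zero.mpr (Ne.symm (H.np c))

theorem hO : h ∈ O := H.le_O 0 H.hR

/-- (P1) at stage `N ≥ 1`: `(h − c^p)/π^a ∈ R N ⇒ a ≤ e₀ + N`. [folklore] -/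
theorem P1 {N : ℕ} (hN : 1 ≤ N) {c : K} {a : ℕ} (hF : (h - c ^ p) / π ^ a ∈ R N) : a ≤ e₀ + N := by
  let E : Derivation ℤ K K := (π ^ N * s) • D
  have hE : ∀ y, E y = π ^ N * s * D y := fun y => by simp [E, smul_eq_mul]
  have hEN : ∀ y ∈ R N, E y ∈ R N := fun y hy => by rw [hE]; exact H.derN N y hy
  have hEπ : ∃ ε ∈ R N, E π = π * ε := by
    obtain ⟨ε, hε, h1⟩ := H.derNπ hN
    exact ⟨ε, hε, by rw [hE, h1]⟩
  refine jacobian_bound_of_isUnit E hEN (H.πRi N) H.π0 (H.πmem N) hEπ hF (H.uRi N) (H.u_unit N) (a := a) (e := e₀ + N) ?_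
  have e1 : π ^ a * ((h - c ^ p) / π ^ a) = h - c ^ p := mul_div_cancel₀ _ (pow_ne_zero a H.π0)
  rw [e1, map_sub, derivation_pow_p, sub_zero, hE, H.derNh]

/-- `v(h − c^p) = v(π)^m` and `(h − c^p)/π^a ∈ R N` give `a ≤ m` and `v((h − c^p)/π^a) = v(π)^(m−a)`. -/
theorem exists_delta {N : ℕ} {c : K} {a m : ℕ} (hF : (h - c ^ p) / π ^ a ∈ R N)
    (hm : O.valuation (h - c ^ p) = O.valuation π ^ m) :
    ∃ δ : ℕ, m = a + δ ∧ O.valuation ((h - c ^ p) / π ^ a) = O.valuation π ^ δ := by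
  have hvπa : O.valuation π ^ a ≠ 0 := pow_ne_zero a H.vπpos.ne'
  have hvF : O.valuation ((h - c ^ p) / π ^ a) = O.valuation π ^ m / O.valuation π ^ a := by
    rw [map_div₀, map_pow, hm]
  have hle1 : O.valuation ((h - c ^ p) / π ^ a) ≤ 1 := (O.valuation_le_one_iff _).mpr (H.le_O N hF)
  have ham : a ≤ m := by
    rw [hvF, div_le_one₀ (zero_lt_iff.mpr hvπa)] at hle1
    exact H.pow_le_pow_iff.mp hle1
  obtain ⟨δ, rfl⟩ := Nat.exists_eq_add_of_le ham
  refine ⟨δ, rfl, ?_⟩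
  rw [hvF, pow_add, mul_div_cancel_left₀ _ hvπa]

theorem exists_ord (c : K) (hc : c ∈ O) : ∃ m : ℕ, O.valuation (h - c ^ p) = O.valuation π ^ m :=
  exists_valuation_eq_pow_of_discrete O π H.πmax H.arch (h - c ^ p) (H.f_ne c) (O.sub_mem H.hO (O.pow_mem hc p))

theorem p_dvd_ord {c : K} (hc : c ∈ O) {m : ℕ} (hm : O.valuation (h - c ^ p) = O.valuation π ^ m) : p ∣ m := by
  obtain ⟨j, hj⟩ := valuation_sub_pow_eq_pow_mul O π H.π0 H.vπ H.πmax H.arch h H.hO H.np H.defect c hc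
  rw [hm] at hj
  exact ⟨j, H.pow_inj hj⟩

/-- The bonus of the termination measure. -/
def bonus (δ : ℕ) : ℕ := if δ = 0 then 1 else if δ = 1 then 2 else 0

omit hRloc H hp in
theorem bonus_le (δ : ℕ) : bonus δ ≤ 2 := by
  unfold bonus; split_ifs <;> omega

/-- **The potential induction** (P3)–(P5): from any state `(N, c, a)` with `(h − c^p)/π^a ∈ R N` the algorithm reaches an exit. -/
theorem core_aux : ∀ (μ : ℕ) (N a m : ℕ) (c : K), c ∈ R N → (h - c ^ p) / π ^ a ∈ R N →
    O.valuation (h - c ^ p) = O.valuation π ^ m → 3 * (e₀ + N - a) + bonus (m - a) ≤ μ →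
    ∃ (n : ℕ) (c' : K), CoreExit R p π h n c' := by
  intro μ
  induction μ using Nat.strong_induction_on with
  | _ μ ih =>
  intro N a m c hcR hF hm hμ
  classical
  obtain ⟨δ, rfl, hvF⟩ := H.exists_delta hF hm
  rw [Nat.add_sub_cancel_left] at hμ
  set f : K := h - c ^ p with hfdef
  set F : K := f / π ^ a with hFdef
  have hfF : f = π ^ a * F := by rw [hFdef, mul_div_cancel₀ _ (pow_ne_zero a H.π0)]
  have hcO : c ∈ O := H.le_O N hcR
  let Fr : R N := ⟨F, hF⟩
  rcases Nat.lt_or_ge δ 1 with hδ | hδ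
  · -- δ = 0 : unit case (P3)
    have hδ0 : δ = 0 := by omega
    subst hδ0
    rw [pow_zero] at hvF
    have hunit : IsUnit Fr := isUnit_of_valuation_eq_one R H.dom0 H.step N F hF hvF
    obtain ⟨j, hj⟩ := H.p_dvd_ord hcO hm
    rw [Nat.add_zero] at hj
    by_cases hβ : ∃ β : R N, Fr - β ^ p ∈ maximalIdeal (R N)
    · -- update `c ↦ c + π^j β`
      obtain ⟨β, hβ⟩ := hβ
      set c' : K := c + π ^ j * (β : K) with hc'def
      have hc'R : c' ∈ R N := (R N).add_mem hcR ((R N).mul_mem ((R N).pow_mem (H.πRi N) j) β.2)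
      have hf' : h - c' ^ p = π ^ a * (F - (β : K) ^ p) := by
        rw [hc'def, add_pow_char, mul_pow, ← pow_mul, mul_comm j p, ← hj, mul_sub, ← hfF, hfdef]; ring
      have hF' : (h - c' ^ p) / π ^ a ∈ R N := by
        rw [hf', mul_div_cancel_left₀ _ (pow_ne_zero a H.π0)]
        exact (R N).sub_mem hF ((R N).pow_mem β.2 p)
      obtain ⟨m', hm'⟩ := H.exists_ord c' (H.le_O N hc'R)
      obtain ⟨δ', hδ'eq, hvF'⟩ := H.exists_delta hF' hm'
      -- `δ' ≥ 2`
      have hvlt : O.valuation ((h - c' ^ p) / π ^ a) < 1 := by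
        rw [hf', mul_div_cancel_left₀ _ (pow_ne_zero a H.π0)]
        exact (H.mem_max N (Fr - β ^ p)).mp hβ
      have hδ'pos : 0 < δ' := by
        rw [hvF'] at hvlt
        by_contra h0
        have : δ' = 0 := by omega
        rw [this, pow_zero] at hvlt
        exact lt_irrefl _ hvlt
      have hpd : p ∣ m' := H.p_dvd_ord (H.le_O N hc'R) hm'
      have hδ'2 : 2 ≤ δ' := by
        have hp2 : 2 ≤ p := hp.out.two_le
        obtain ⟨j', hj'⟩ := hpd
        have : p * j < p * j' := by rw [← hj, ← hj', hδ'eq]; omega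
        have hjj : j + 1 ≤ j' := Nat.lt_of_mul_lt_mul_left this
        have : a + δ' = p * j' := by rw [← hδ'eq, hj']
        nlinarith
      refine ih _ ?_ N a m' c' hc'R hF' hm' le_rfl
      rw [hδ'eq, Nat.add_sub_cancel_left]
      have hb : bonus δ' = 0 := by unfold bonus; rw [if_neg (by omega), if_neg (by omega)]
      have hb0 : bonus 0 = 1 := by unfold bonus; rw [if_pos rfl]
      rw [hb0] at hμ; rw [hb]; omega
    · -- EXIT, loose clean form (2)
      push Not at hβ
      refine ⟨N, c, Or.inr (Or.inl ⟨j, Fr, hunit, ?_, hβ⟩)⟩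
      change F = (h - c ^ p) / π ^ (p * j)
      rw [← hj]
  rcases Nat.lt_or_ge δ 2 with hδ2 | hδ2
  · -- δ = 1 : blow up (shape L2)
    have hδ1 : δ = 1 := by omega
    subst hδ1
    rw [pow_one] at hvF
    have hvF1 : O.valuation F < 1 := by rw [hvF]; exact H.vπ
    have hF' : F / π ∈ R (N + 1) := div_mem_succ_of_lt R H.dom0 H.step π H.πR H.π0 H.vπ H.πmax N F hF hvF1
    have hF'' : (h - c ^ p) / π ^ (a + 1) ∈ R (N + 1) := by
      have e : (h - c ^ p) / π ^ (a + 1) = F / π := by rw [hFdef, hfdef, pow_succ, div_div]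
      rw [e]; exact hF'
    refine ih _ ?_ (N + 1) (a + 1) (a + 1) c (H.mono (Nat.le_succ N) hcR) hF'' hm le_rfl
    have e1 : e₀ + (N + 1) - (a + 1) = e₀ + N - a := by omega
    rw [e1, Nat.sub_self]
    have hb0 : bonus 0 = 1 := by unfold bonus; rw [if_pos rfl]
    have hb1 : bonus 1 = 2 := by unfold bonus; rw [if_neg one_ne_zero, if_pos rfl]
    rw [hb1] at hμ; rw [hb0]; omega
  -- δ ≥ 2
  have hvF1 : O.valuation F < 1 := by
    rw [hvF]; exact pow_lt_one₀ zero_le H.vπ (by omega)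
  have hFm : Fr ∈ maximalIdeal (R N) := (H.mem_max N Fr).mpr hvF1
  have hbδ : bonus δ = 0 := by unfold bonus; rw [if_neg (by omega), if_neg (by omega)]
  rw [hbδ, Nat.add_zero] at hμ
  by_cases hF2 : Fr ∈ maximalIdeal (R N) ^ 2
  · -- blow up (shape L1): `a` rises by `2`
    have hF' : F / π ^ 2 ∈ R (N + 1) := div_pow_mem_succ_of_mem_pow R H.dom0 H.step π H.πR H.π0 H.vπ H.πmax N 2 Fr hF2
    have hF'' : (h - c ^ p) / π ^ (a + 2) ∈ R (N + 1) := by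
      have e : (h - c ^ p) / π ^ (a + 2) = F / π ^ 2 := by rw [hFdef, hfdef, pow_add, div_div]
      rw [e]; exact hF'
    have hP1 := H.P1 (Nat.le_add_left 1 N) hF''
    refine ih _ ?_ (N + 1) (a + 2) (a + δ) c (H.mono (Nat.le_succ N) hcR) hF'' hm le_rfl
    have hb := bonus_le (a + δ - (a + 2))
    omega
  · -- EXIT by the valuative detector (P2)
    have hvF2 : O.valuation (Fr : K) ≤ O.valuation π ^ 2 := by
      change O.valuation F ≤ _; rw [hvF]; exact H.pow_le_pow_iff.mpr hδ2
    have hind : ∀ a' b' : R N, a' * ⟨π, H.πRi N⟩ + b' * Fr ∈ maximalIdeal (R N) ^ 2 → b' ∈ maximalIdeal (R N) :=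
      fun a' b' hab => (indep_of_valuation (H.dom N) (H.πRi N) H.π0 (H.πmem N) H.πmax Fr hFm hF2 hvF2 a' b' hab).2
    haveI : IsRegularLocalRing (R N) := H.reg N
    obtain ⟨x₀, x₁, x₂, hx⟩ := exists_span_triple (H.reg N) (H.dim N)
    obtain ⟨t₃, ht₃⟩ := exists_span_triple_of_indep x₀ x₁ x₂ ⟨π, H.πRi N⟩ Fr hx (H.πmem N) (H.πnot2 N) hFm hind
    by_cases hpa : p ∣ a
    · -- loose clean form (3)
      obtain ⟨m', hm'⟩ := hpa
      refine ⟨N, c, Or.inl ⟨m', Fr, hFm, hF2, ?_⟩⟩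
      change F = (h - c ^ p) / π ^ (p * m')
      rw [← hm']
    · -- loose clean form (1) with exponents `(r, 1)`
      refine ⟨N, c, Or.inr (Or.inr ⟨a / p, a % p, H.πRi N, Fr, t₃, Nat.pos_of_ne_zero fun h0 => hpa
        (Nat.dvd_of_mod_eq_zero h0), Nat.mod_lt a hp.out.pos, ht₃, ?_⟩)⟩
      change (h - c ^ p) / π ^ (p * (a / p)) = π ^ (a % p) * F
      have hdm : a = p * (a / p) + a % p := (Nat.div_add_mod a p).symm
      rw [← hfdef, hfF]
      nth_rw 1 [hdm]
      rw [pow_add, mul_assoc, mul_div_cancel_left₀ _ (pow_ne_zero _ H.π0)]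

/-- **THEOREM P, core form.** [folklore] -/
theorem core : ∃ (n : ℕ) (c : K), CoreExit R p π h n c := by
  obtain ⟨m, hm⟩ := H.exists_ord 0 O.zero_mem
  refine H.core_aux _ 0 0 m 0 (R 0).zero_mem ?_ hm le_rfl
  rw [pow_zero, div_one, zero_pow hp.out.ne_zero, sub_zero]
  exact H.hR

end CoreHyp

end Core


/-! ## From the exits to the conclusion of the stub -/

section Conclusion

variable {k : Type} [Field k] [Algebra k K]

/-- The conclusion of `stub_cleanLU3Defect…` (verbatim copy of `Census_lens5_arcPotential.ArcConcl`). -/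
def ArcConcl (p : ℕ) (k K : Type) [Field k] [Field K] [Algebra k K] (O : ValuationSubring K) (A : Subalgebra k K)
    (g₀ : K) : Prop :=
  ∃ (A' : Subalgebra k K), A'.toSubring ≤ O.toSubring ∧ A ≤ A' ∧ A'.FG ∧
    ∃ (_ : IsRegularLocalRing (locAtCentre A'.toSubring O)) (c : Fin p → K), (∃ j : Fin p, (j : ℕ) ≠ 0 ∧ c j ≠ 0) ∧
    ((∃ (d m : ℕ) (hmd : m ≤ d) (t : Fin d → ↥(locAtCentre A'.toSubring O)) (a : Fin m → ℕ) (u : ↥(locAtCentre A'.toSubring O)), IsUnit u ∧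
    Ideal.span (Set.range t) = IsLocalRing.maximalIdeal ↥(locAtCentre A'.toSubring O) ∧
    ringKrullDim ↥(locAtCentre A'.toSubring O) = (d : WithBot ℕ∞) ∧ 0 < m ∧ (∀ i, ¬ p ∣ a i) ∧
    (∑ j : Fin p, c j ^ p * g₀ ^ (j : ℕ)) = (u : K) * ∏ i : Fin m, ((t (Fin.castLE hmd i) : ↥(locAtCentre A'.toSubring O)) : K) ^ (a i)) ∨
    (∃ u : ↥(locAtCentre A'.toSubring O), IsUnit u ∧ (∑ j : Fin p, c j ^ p * g₀ ^ (j : ℕ)) = (u : K) ∧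
    ∀ c' : ↥(locAtCentre A'.toSubring O), u - c' ^ p ∉ IsLocalRing.maximalIdeal ↥(locAtCentre A'.toSubring O)) ∨
    (∃ s c' : ↥(locAtCentre A'.toSubring O), (∑ j : Fin p, c j ^ p * g₀ ^ (j : ℕ)) = (s : K) ∧
    s - c' ^ p ∈ IsLocalRing.maximalIdeal ↥(locAtCentre A'.toSubring O) ∧
    s - c' ^ p ∉ IsLocalRing.maximalIdeal ↥(locAtCentre A'.toSubring O) ^ 2))

/-- Exit (3) ⇒ conclusion (this is ✓ `conclusion_of_core`). -/
theorem concl_of_exit3 {p : ℕ} [hp : Fact p.Prime] [CharP K p] {O : ValuationSubring K} {A A' : Subalgebra k K}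
    (hA'O : A'.toSubring ≤ O.toSubring) (hAA' : A ≤ A') (hA'fg : A'.FG)
    (Rn : Subring K) [IsLocalRing Rn] (hreg : IsRegularLocalRing Rn) (hRn : Rn = locAtCentre A'.toSubring O)
    (g₀ b c π : K) (hb : b ≠ 0) (hπ0 : π ≠ 0) (m' : ℕ)
    (G : Rn) (hGm : G ∈ maximalIdeal Rn) (hGm2 : G ∉ maximalIdeal Rn ^ 2) (hG : (G : K) = (b ^ p * g₀ - c ^ p) / π ^ (p * m')) :
    ArcConcl p k K O A g₀ :=
  conclusion_of_core hA'O hAA' hA'fg Rn hreg hRn g₀ b c π hb hπ0 m' G hGm hGm2 hG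

/-- Exit (2) ⇒ conclusion. [folklore] -/
theorem concl_of_exit2 {p : ℕ} [hp : Fact p.Prime] [CharP K p] {O : ValuationSubring K} {A A' : Subalgebra k K}
    (hA'O : A'.toSubring ≤ O.toSubring) (hAA' : A ≤ A') (hA'fg : A'.FG)
    (Rn : Subring K) [IsLocalRing Rn] (hreg : IsRegularLocalRing Rn) (hRn : Rn = locAtCentre A'.toSubring O)
    (g₀ b c π : K) (hb : b ≠ 0) (hπ0 : π ≠ 0) (m' : ℕ)
    (U : Rn) (hU : IsUnit U) (hUeq : (U : K) = (b ^ p * g₀ - c ^ p) / π ^ (p * m'))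
    (hres : ∀ c' : Rn, U - c' ^ p ∉ maximalIdeal Rn) :
    ArcConcl p k K O A g₀ := by
  subst hRn
  refine ⟨A', hA'O, hAA', hA'fg, hreg,
    fun j : Fin p => if (j : ℕ) = 0 then -c / π ^ m' else if (j : ℕ) = 1 then b / π ^ m' else 0, ?_, ?_⟩
  · refine ⟨⟨1, hp.out.one_lt⟩, one_ne_zero, ?_⟩
    simp only [one_ne_zero, if_false, if_true]
    exact div_ne_zero hb (pow_ne_zero _ hπ0)
  · refine Or.inr (Or.inl ⟨U, hU, ?_, hres⟩)
    rw [sum_rep_eq, hUeq]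

/-- Exit (1) ⇒ conclusion: the monomial `π^r F` with `(π, F, t₃)` a regular system of parameters, `0 < r < p`. [folklore] -/
theorem concl_of_exit1 {p : ℕ} [hp : Fact p.Prime] [CharP K p] {O : ValuationSubring K} {A A' : Subalgebra k K}
    (hA'O : A'.toSubring ≤ O.toSubring) (hAA' : A ≤ A') (hA'fg : A'.FG)
    (Rn : Subring K) [IsLocalRing Rn] (hreg : IsRegularLocalRing Rn) (hRn : Rn = locAtCentre A'.toSubring O)
    (hdimRn : ringKrullDim Rn = 3)
    (g₀ b c π : K) (hb : b ≠ 0) (hπ0 : π ≠ 0) (m' r : ℕ) (hr0 : 0 < r) (hrp : r < p)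
    (hπn : π ∈ Rn) (F t₃ : Rn) (hm : maximalIdeal Rn = Ideal.span {⟨π, hπn⟩, F, t₃})
    (heq : (b ^ p * g₀ - c ^ p) / π ^ (p * m') = π ^ r * (F : K)) :
    ArcConcl p k K O A g₀ := by
  subst hRn
  refine ⟨A', hA'O, hAA', hA'fg, hreg,
    fun j : Fin p => if (j : ℕ) = 0 then -c / π ^ m' else if (j : ℕ) = 1 then b / π ^ m' else 0, ?_, ?_⟩
  · refine ⟨⟨1, hp.out.one_lt⟩, one_ne_zero, ?_⟩
    simp only [one_ne_zero, if_false, if_true]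
    exact div_ne_zero hb (pow_ne_zero _ hπ0)
  · refine Or.inl ⟨3, 2, by norm_num, ![⟨π, hπn⟩, F, t₃], ![r, 1], 1, isUnit_one, ?_, ?_, by norm_num, ?_, ?_⟩
    · rw [hm]
      congr 1
      ext t
      simp only [Set.mem_range, Set.mem_insert_iff, Set.mem_singleton_iff]
      constructor
      · rintro ⟨i, rfl⟩
        fin_cases i <;> simp
      · rintro (rfl | rfl | rfl)
        · exact ⟨0, rfl⟩
        · exact ⟨1, rfl⟩
        · exact ⟨2, rfl⟩
    · rw [hdimRn]; rfl
    · intro i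
      fin_cases i
      · exact Nat.not_dvd_of_pos_of_lt hr0 hrp
      · exact hp.out.not_dvd_one
    · rw [sum_rep_eq, heq, Fin.prod_univ_two, Subring.coe_one, one_mul]
      change π ^ r * (F : K) = ((⟨π, hπn⟩ : ↥(locAtCentre A'.toSubring O)) : K) ^ r * (F : K) ^ 1
      rw [pow_one]

end Conclusion

/-! ## THEOREM P -/

section Main

variable {k : Type} [Field k] [Algebra k K]

/-- **THEOREM P** (memo e709ae1b8c5f §2): class (A) — discrete rank-one `O`, `g₀` with no best `p`-th-power approximation, a
derivation moving `g₀` with bounded denominators on `A` — has clean local uniformization in loose clean form, for EVERY residue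
tower and EVERY ground field.  (= ✓ `cleanLU3Defect_of_discrete_of_finiteResidue` without its finite-residue hypothesis; `htd`,
`hdimA` unused.) [folklore] -/
theorem arcPotential (p : ℕ) (hp : p.Prime) (k : Type) [Field k] [CharP k p] (K : Type) [Field K] [Algebra k K]
    (O : ValuationSubring K) (A : Subalgebra k K) (hAO : A.toSubring ≤ O.toSubring) (hAfg : A.FG)
    (hfrac : IsFractionRing A K) (_hdimA : ringKrullDim A ≤ 3) (hreg : IsRegularLocalRing (locAtCentre A.toSubring O))
    (hdim3 : ringKrullDim (locAtCentre A.toSubring O) = 3)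
    (hzd : ∀ (T : Subring K) (hT : T ≤ O.toSubring), A.toSubring ≤ T → (subringCentre T O hT).IsMaximal)
    (g₀ : K) (hg₀ : ∀ c : K, c ^ p ≠ g₀)
    (hdefect : ∀ f₀ : K, ∃ f₁ : K, O.valuation (g₀ - f₁ ^ p) < O.valuation (g₀ - f₀ ^ p))
    (_htd : ∀ hk : ∀ c : k, algebraMap k K c ∈ O, transcendenceDefect k O hk ≠ 0)
    (hdisc : ∃ π : K, π ≠ 0 ∧ (∀ x : K, O.valuation x < 1 → O.valuation x ≤ O.valuation π) ∧
      (∀ x : K, x ≠ 0 → ∃ n : ℕ, O.valuation π ^ n ≤ O.valuation x))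
    (hDer : ∃ (D : Derivation ℤ K K) (s : K), s ≠ 0 ∧ (∀ y : K, y ∈ A → s * D y ∈ A) ∧ D g₀ ≠ 0) :
    ArcConcl p k K O A g₀ := by
  obtain ⟨π, hπ0, hπ, harch⟩ := hdisc
  obtain ⟨D, s, hs0, hDA, hDg⟩ := hDer
  classical
  haveI : Fact p.Prime := ⟨hp⟩
  haveI : CharP K p := charP_of_injective_algebraMap (algebraMap k K).injective p
  -- (0) the quadratic sequence package
  have hd : ringKrullDim (locAtCentre A.toSubring O) ≠ 0 := by
    intro h0; rw [hdim3] at h0; exact absurd h0 (by decide)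
  obtain ⟨R, hR0, hstep, hregR, hdimR, hmodel⟩ := exists_quadraticSeq_package A O hAO hAfg hreg hd hzd
  haveI hRloc : ∀ i, IsLocalRing (R i) := fun i => by haveI := hregR i; infer_instance
  have h0dom : SubringDominates (R 0) O.toSubring := by rw [hR0]; exact subringDominates_locAtCentre hAO
  have hdom : ∀ i, SubringDominates (R i) O.toSubring := fun i => (sequence_dominates h0dom hstep i).1
  have hmono : ∀ {i j : ℕ}, i ≤ j → R i ≤ R j := fun hij => sequence_monotone hstep hij
  have hof : IsLocalRingOf (R 0) := by rw [hR0]; exact isLocalRingOf_locAtCentre A O hAO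
  have hdim3R : ∀ i, ringKrullDim (R i) = 3 := fun i => (hdimR i).trans hdim3
  have hAR0 : A.toSubring ≤ R 0 := by rw [hR0]; exact le_locAtCentre _ O
  have hmemR : ∀ i (a : R i), a ∈ maximalIdeal (R i) ↔ O.valuation (a : K) < 1 := fun i =>
    (subringDominates_valuationSubring_iff (hdom i).1).mp (hdom i)
  -- (1) `h = b^p g₀ ∈ A`
  obtain ⟨a, b, hb, hab⟩ := IsFractionRing.div_surjective (A := A) g₀
  have hab' : (a : K) / (b : K) = g₀ := hab
  have hb0 : (b : K) ≠ 0 := fun h => nonZeroDivisors.ne_zero hb (Subtype.ext h)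
  set h : K := (b : K) ^ p * g₀ with hhdef
  have hhA : h ∈ A := by
    have : h = (a : K) * (b : K) ^ (p - 1) := by
      obtain ⟨q, hq⟩ : ∃ q, p = q + 1 := ⟨p - 1, (Nat.sub_add_cancel hp.one_lt.le).symm⟩
      rw [hhdef, ← hab', hq, Nat.add_sub_cancel, pow_succ]
      field_simp
    rw [this]
    exact A.mul_mem a.2 (A.pow_mem b.2 _)
  -- `v π < 1`, `π ∈ O`
  have hne0 : maximalIdeal (R 0) ≠ ⊥ := by
    intro hbot
    have hfield : IsField (R 0) := IsLocalRing.isField_iff_maximalIdeal_eq.mpr hbot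
    have h0 : ringKrullDim (R 0) = 0 := ringKrullDim_eq_zero_of_isField hfield
    rw [hdim3R] at h0; exact absurd h0 (by decide)
  obtain ⟨m₀, hm₀m, hm₀0⟩ := Submodule.exists_mem_ne_zero_of_ne_bot hne0
  have hvπ : O.valuation π < 1 := by
    have hvm : O.valuation (m₀ : K) < 1 := (hmemR 0 m₀).mp hm₀m
    have hm0' : (m₀ : K) ≠ 0 := fun h0 => hm₀0 (Subtype.ext h0)
    obtain ⟨n, hn⟩ := harch _ hm0'
    by_contra hge
    push Not at hge
    have : (1 : O.ValueGroup) ≤ O.valuation π ^ n := one_le_pow₀ hge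
    exact absurd (this.trans hn) (not_le.mpr hvm)
  have hπO : π ∈ O := by rw [← O.valuation_le_one_iff]; exact hvπ.le
  have hvπpos : 0 < O.valuation π := zero_lt_iff.mpr ((Valuation.ne_zero_iff _).mpr hπ0)
  -- (2) transport of the derivation
  have hD0 : ∀ y ∈ R 0, s * D y ∈ R 0 := by
    rw [hR0]
    exact mul_derivation_mem_locAtCentre D s (B := A.toSubring) (O := O) (fun y hy => hDA y hy)
  have hDer := exists_derivation_preserving_seq R hstep D s hs0 hD0
  -- (3) climb until `π` is absorbed
  obtain ⟨n₁, hπn₁⟩ := exists_mem_of_quadraticTransforms_of_discrete O R hof h0dom hstep π hπ harch π hπO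
  -- the restarted sequence at `n₁`
  let R' : ℕ → Subring K := fun i => R (n₁ + i)
  haveI hR'loc : ∀ i, IsLocalRing (R' i) := fun i => hRloc (n₁ + i)
  have hstep' : ∀ i, IsQuadraticTransformAlong O (R' i) (R' (i + 1)) := fun i => by
    change IsQuadraticTransformAlong O (R (n₁ + i)) (R (n₁ + (i + 1)))
    rw [← add_assoc]; exact hstep (n₁ + i)
  have h0' : SubringDominates (R' 0) O.toSubring := hdom (n₁ + 0)
  have hπR' : π ∈ R' 0 := hπn₁
  -- the derivation at stage `n₁`, `E h = π^o u`
  obtain ⟨s₁, hs₁0, hD₁⟩ := hDer n₁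
  have hDh : D h = (b : K) ^ p * D g₀ := by
    rw [hhdef, Derivation.leibniz, Derivation.leibniz_pow]
    simp [smul_eq_mul, nsmul_eq_mul]
  have hEh0 : s₁ * D h ≠ 0 := mul_ne_zero hs₁0 (by rw [hDh]; exact mul_ne_zero (pow_ne_zero _ hb0) hDg)
  have hhR : h ∈ R n₁ := hmono (Nat.zero_le n₁) (hAR0 hhA)
  have hEhR : s₁ * D h ∈ R' 0 := hD₁ h hhR
  have hEhO : s₁ * D h ∈ O := (hdom n₁).1 hEhR
  obtain ⟨o, ho⟩ := exists_valuation_eq_pow_of_discrete O π hπ harch (s₁ * D h) hEh0 hEhO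
  obtain ⟨u, huR, hvu, hEu⟩ := exists_eq_pow_mul_unit R' h0' hstep' π hπR' hπ0 hvπ hπ o 0 (s₁ * D h) hEhR ho
  rw [Nat.zero_add] at huR
  -- restart again at `n₂ := n₁ + o`
  let R'' : ℕ → Subring K := fun i => R (n₁ + o + i)
  haveI hR''loc : ∀ i, IsLocalRing (R'' i) := fun i => hRloc (n₁ + o + i)
  have hstep'' : ∀ i, IsQuadraticTransformAlong O (R'' i) (R'' (i + 1)) := fun i => by
    change IsQuadraticTransformAlong O (R (n₁ + o + i)) (R (n₁ + o + (i + 1)))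
    rw [← add_assoc]; exact hstep (n₁ + o + i)
  have hder'' : ∀ y ∈ R'' 0, π ^ o * s₁ * D y ∈ R'' 0 :=
    derivation_transport_pow R' h0' hstep' π hπR' hπ0 hvπ hπ D s₁ hD₁ o
  have H : CoreHyp O p R'' π D (π ^ o * s₁) h u (o + o) :=
    { reg := fun i => hregR _
      dim := fun i => hdim3R _
      dom0 := hdom _
      step := hstep''
      πR := hmono (Nat.le_add_right n₁ o) hπn₁
      π0 := hπ0
      vπ := hvπ
      πmax := hπ
      arch := harch
      der := hder''
      hR := hmono (Nat.le_add_right n₁ o) hhR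
      np := by
        intro c hc
        apply hg₀ (c / (b : K))
        rw [div_pow, hc, hhdef, mul_div_cancel_left₀ _ (pow_ne_zero _ hb0)]
      defect := by
        intro c
        obtain ⟨f₁, hf₁⟩ := hdefect (c / (b : K))
        refine ⟨(b : K) * f₁, ?_⟩
        have e1 : h - ((b : K) * f₁) ^ p = (b : K) ^ p * (g₀ - f₁ ^ p) := by rw [hhdef]; ring
        have e2 : h - c ^ p = (b : K) ^ p * (g₀ - (c / (b : K)) ^ p) := by
          rw [hhdef, div_pow, mul_sub, mul_div_cancel₀ _ (pow_ne_zero _ hb0)]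
        rw [e1, e2, map_mul, map_mul]
        have hbp : 0 < O.valuation ((b : K) ^ p) :=
          zero_lt_iff.mpr ((Valuation.ne_zero_iff _).mpr (pow_ne_zero _ hb0))
        by_contra hle
        push Not at hle
        exact absurd (le_of_mul_le_mul_left hle hbp) (not_le.mpr hf₁)
      uR := huR
      vu := hvu
      Dh := by rw [mul_assoc, hEu]; ring }
  -- run the algorithm
  obtain ⟨n, c, hexit⟩ := H.core
  obtain ⟨A', hA'O, hAA', hA'fg, hRn⟩ := hmodel (n₁ + o + n)
  have hregn : IsRegularLocalRing (R'' n) := hregR _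
  rcases hexit with ⟨m', G, hGm, hGm2, hG⟩ | ⟨m', U, hU, hUeq, hres⟩ | ⟨m', r, hπn, F, t₃, hr0, hrp, hm, heq⟩
  · exact concl_of_exit3 hA'O hAA' hA'fg (R'' n) hregn hRn g₀ (b : K) c π hb0 hπ0 m' G hGm hGm2 (by rw [hG])
  · exact concl_of_exit2 hA'O hAA' hA'fg (R'' n) hregn hRn g₀ (b : K) c π hb0 hπ0 m' U hU (by rw [hUeq]) hres
  · exact concl_of_exit1 hA'O hAA' hA'fg (R'' n) hregn hRn (hdim3R _) g₀ (b : K) c π hb0 hπ0 m' r hr0 hrp hπn F t₃ hm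
      (by rw [← heq])

end Main


/-! ## The typed targets, closed -/

section Targets

/-- Verbatim copy of `Census_lens5_arcPotential.AbsDerivationMovesAt` (46f6cec37822); PROVED for prime `p` as
✓ `…CpSibling.AbsDerivation.absDerivationMovesAt_holds` (Cruxes workfile `Lens5_AbsDerivation.lean`, d237cf907357). -/
def AbsDerivationMovesAt (p : ℕ) : Prop :=
  ∀ (k : Type) [Field k] [CharP k p] (K : Type) [Field K] [Algebra k K] (A : Subalgebra k K), A.FG → IsFractionRing A K →
    ∀ g₀ : K, (∀ c : K, c ^ p ≠ g₀) →
    ∃ (D : Derivation ℤ K K) (s : K), s ≠ 0 ∧ (∀ y : K, y ∈ A → s * D y ∈ A) ∧ D g₀ ≠ 0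

/-- Verbatim copy of `Census_lens5_arcPotential.ArcPotentialAt` (46f6cec37822). -/
def ArcPotentialAt (p : ℕ) : Prop :=
  ∀ (k : Type) [Field k] [CharP k p] (K : Type) [Field K] [Algebra k K]
    (O : ValuationSubring K) (A : Subalgebra k K), A.toSubring ≤ O.toSubring → A.FG → IsFractionRing A K →
    ringKrullDim A ≤ 3 → IsRegularLocalRing (locAtCentre A.toSubring O) →
    ringKrullDim (locAtCentre A.toSubring O) = 3 →
    (∀ (T : Subring K) (hT : T ≤ O.toSubring), A.toSubring ≤ T → (subringCentre T O hT).IsMaximal) →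
    ∀ g₀ : K, (∀ c : K, c ^ p ≠ g₀) →
    (∀ f₀ : K, ∃ f₁ : K, O.valuation (g₀ - f₁ ^ p) < O.valuation (g₀ - f₀ ^ p)) →
    (∀ hk : ∀ c : k, algebraMap k K c ∈ O, transcendenceDefect k O hk ≠ 0) →
    (∃ π : K, π ≠ 0 ∧ (∀ x : K, O.valuation x < 1 → O.valuation x ≤ O.valuation π) ∧
      (∀ x : K, x ≠ 0 → ∃ n : ℕ, O.valuation π ^ n ≤ O.valuation x)) →
    (∃ (D : Derivation ℤ K K) (s : K), s ≠ 0 ∧ (∀ y : K, y ∈ A → s * D y ∈ A) ∧ D g₀ ≠ 0) →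
    ArcConcl p k K O A g₀

/-- **THEOREM P, typed target closed.** [folklore] -/
theorem arcPotentialAt_holds {p : ℕ} (hp : p.Prime) : ArcPotentialAt p := by
  intro k _ _ K _ _ O A hAO hAfg hfrac hdimA hreg hdim3 hzd g₀ hg₀ hdefect htd hdisc hDer
  exact arcPotential p hp k K O A hAO hAfg hfrac hdimA hreg hdim3 hzd g₀ hg₀ hdefect htd hdisc hDer

/-- **The lead's `stub_cleanLU3DefectArcInfinite` (CleanModels `Lines/Sketch.lean` rev 20, statement VERBATIM) from THEOREM P and
LEMMA D-abs.**  The only hypothesis `hD` is ✓ `absDerivationMovesAt_holds` of `Cruxes/DescentPerfectToAll/Lens5_AbsDerivation.lean`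
(d237cf907357, sorry-free; not importable from here because Cruxes modules are not built on the farm) — once both files are landed under
`Theorems/`, `cleanLU3DefectArcInfinite_of_absDerivation (fun p hp => absDerivationMovesAt_holds hp)` is the stub.  Note that the
infinite-residue-tower hypothesis (the last binder) is NOT used: THEOREM P is uniform in the residue tower. [folklore] -/
theorem cleanLU3DefectArcInfinite_of_absDerivation (hD : ∀ p : ℕ, p.Prime → AbsDerivationMovesAt p) :
    ∀ (p : ℕ), p.Prime →
    ∀ (k : Type) [Field k] [CharP k p] (K : Type) [Field K] [Algebra k K]
    (O : ValuationSubring K) (A : Subalgebra k K), A.toSubring ≤ O.toSubring → A.FG → IsFractionRing A K →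
    ringKrullDim A ≤ 3 → IsRegularLocalRing (locAtCentre A.toSubring O) →
    ringKrullDim (locAtCentre A.toSubring O) = 3 →
    (∀ (T : Subring K) (hT : T ≤ O.toSubring), A.toSubring ≤ T → (subringCentre T O hT).IsMaximal) →
    ∀ g₀ : K, (∀ c : K, c ^ p ≠ g₀) →
    (∀ f₀ : K, ∃ f₁ : K, O.valuation (g₀ - f₁ ^ p) < O.valuation (g₀ - f₀ ^ p)) →
    (∀ hk : ∀ c : k, algebraMap k K c ∈ O, transcendenceDefect k O hk ≠ 0) →
    (∃ π : K, π ≠ 0 ∧ (∀ x : K, O.valuation x < 1 → O.valuation x ≤ O.valuation π) ∧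
      (∀ x : K, x ≠ 0 → ∃ n : ℕ, O.valuation π ^ n ≤ O.valuation x)) →
    ¬ (∃ S : Finset K, (↑S : Set K) ⊆ O ∧
      ∀ y : K, y ∈ O → ∃ r : K, r ∈ Subring.closure ((locAtCentre A.toSubring O : Set K) ∪ ↑S) ∧ O.valuation (y - r) < 1) →
    ∃ (A' : Subalgebra k K), A'.toSubring ≤ O.toSubring ∧ A ≤ A' ∧ A'.FG ∧
    ∃ (_ : IsRegularLocalRing (locAtCentre A'.toSubring O)) (c : Fin p → K), (∃ j : Fin p, (j : ℕ) ≠ 0 ∧ c j ≠ 0) ∧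
    ((∃ (d m : ℕ) (hmd : m ≤ d) (t : Fin d → ↥(locAtCentre A'.toSubring O)) (a : Fin m → ℕ) (u : ↥(locAtCentre A'.toSubring O)), IsUnit u ∧
    Ideal.span (Set.range t) = IsLocalRing.maximalIdeal ↥(locAtCentre A'.toSubring O) ∧
    ringKrullDim ↥(locAtCentre A'.toSubring O) = (d : WithBot ℕ∞) ∧ 0 < m ∧ (∀ i, ¬ p ∣ a i) ∧
    (∑ j : Fin p, c j ^ p * g₀ ^ (j : ℕ)) = (u : K) * ∏ i : Fin m, ((t (Fin.castLE hmd i) : ↥(locAtCentre A'.toSubring O)) : K) ^ (a i)) ∨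
    (∃ u : ↥(locAtCentre A'.toSubring O), IsUnit u ∧ (∑ j : Fin p, c j ^ p * g₀ ^ (j : ℕ)) = (u : K) ∧
    ∀ c' : ↥(locAtCentre A'.toSubring O), u - c' ^ p ∉ IsLocalRing.maximalIdeal ↥(locAtCentre A'.toSubring O)) ∨
    (∃ s c' : ↥(locAtCentre A'.toSubring O), (∑ j : Fin p, c j ^ p * g₀ ^ (j : ℕ)) = (s : K) ∧
    s - c' ^ p ∈ IsLocalRing.maximalIdeal ↥(locAtCentre A'.toSubring O) ∧
    s - c' ^ p ∉ IsLocalRing.maximalIdeal ↥(locAtCentre A'.toSubring O) ^ 2)) := by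
  intro p hp k _ _ K _ _ O A hAO hAfg hfrac hdimA hreg hdim3 hzd g₀ hg₀ hdefect htd hdisc _
  exact arcPotential p hp k K O A hAO hAfg hfrac hdimA hreg hdim3 hzd g₀ hg₀ hdefect htd hdisc
    (hD p hp k K A hAfg hfrac g₀ hg₀)

/-- The same with the derivation as an explicit datum (no hypothesis on `p`-bases at all): the DISCRETE class (A) with ANY residue
tower, given a derivation moving `g₀` — e.g. the `k`-derivation of ✓ `derivation_of_not_mem_adjoin_pow` (5d37f7a70d6b) when
`g₀ ∉ k[K^p]`. [folklore] -/
theorem cleanLU3DefectArc_of_derivation :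
    ∀ (p : ℕ), p.Prime →
    ∀ (k : Type) [Field k] [CharP k p] (K : Type) [Field K] [Algebra k K]
    (O : ValuationSubring K) (A : Subalgebra k K), A.toSubring ≤ O.toSubring → A.FG → IsFractionRing A K →
    ringKrullDim A ≤ 3 → IsRegularLocalRing (locAtCentre A.toSubring O) →
    ringKrullDim (locAtCentre A.toSubring O) = 3 →
    (∀ (T : Subring K) (hT : T ≤ O.toSubring), A.toSubring ≤ T → (subringCentre T O hT).IsMaximal) →
    ∀ g₀ : K, (∀ c : K, c ^ p ≠ g₀) →
    (∀ f₀ : K, ∃ f₁ : K, O.valuation (g₀ - f₁ ^ p) < O.valuation (g₀ - f₀ ^ p)) →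
    (∀ hk : ∀ c : k, algebraMap k K c ∈ O, transcendenceDefect k O hk ≠ 0) →
    (∃ π : K, π ≠ 0 ∧ (∀ x : K, O.valuation x < 1 → O.valuation x ≤ O.valuation π) ∧
      (∀ x : K, x ≠ 0 → ∃ n : ℕ, O.valuation π ^ n ≤ O.valuation x)) →
    (∃ (D : Derivation ℤ K K) (s : K), s ≠ 0 ∧ (∀ y : K, y ∈ A → s * D y ∈ A) ∧ D g₀ ≠ 0) →
    ArcConcl p k K O A g₀ :=
  fun _ hp => arcPotentialAt_holds hp

end Targets

end Summit.ResolutionOfSingularities.ResolutionOfSingularities.Cruxes.DescentPerfectToAll.CpSibling.ArcPotentialProof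

end

-- ════════ §UNION: the three stubs VERBATIM, no hypotheses ════════
noncomputable section

set_option linter.dupNamespace false

open Literature.AlgebraicGeometry.Resolution
open Summit.ResolutionOfSingularities.ResolutionOfSingularities.Theorems.RadicialJung.CleanModels

namespace Summit.ResolutionOfSingularities.ResolutionOfSingularities.Cruxes.DescentPerfectToAll.CpSibling.ClassA

/-- `stub_derivation_of_not_mem_adjoin_pow` (Sketch rev 20 l.220) VERBATIM. [folklore] -/
theorem stub_derivation_of_not_mem_adjoin_pow_closed :
    ∀ (p : ℕ), p.Prime →
    ∀ (k : Type) [Field k] [CharP k p] (K : Type) [Field K] [Algebra k K] (A : Subalgebra k K), A.FG → IsFractionRing A K →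
    ∀ g₀ : K, g₀ ∉ Algebra.adjoin k (Set.range fun y : K => y ^ p) →
    ∃ (D : Derivation ℤ K K) (s : K), s ≠ 0 ∧ (∀ y : K, y ∈ A → s * D y ∈ A) ∧ D g₀ ≠ 0 :=
  DerivationStub.derivation_of_not_mem_adjoin_pow

/-- `stub_cleanLU3DefectArcConstants` (Sketch rev 20 l.232) VERBATIM. [folklore] -/
theorem stub_cleanLU3DefectArcConstants_closed :
    ∀ (p : ℕ), p.Prime →
    ∀ (k : Type) [Field k] [CharP k p] (K : Type) [Field K] [Algebra k K]
    (O : ValuationSubring K) (A : Subalgebra k K), A.toSubring ≤ O.toSubring → A.FG → IsFractionRing A K →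
    ringKrullDim A ≤ 3 → IsRegularLocalRing (locAtCentre A.toSubring O) →
    ringKrullDim (locAtCentre A.toSubring O) = 3 →
    (∀ (T : Subring K) (hT : T ≤ O.toSubring), A.toSubring ≤ T → (subringCentre T O hT).IsMaximal) →
    ∀ g₀ : K, (∀ c : K, c ^ p ≠ g₀) →
    (∀ f₀ : K, ∃ f₁ : K, O.valuation (g₀ - f₁ ^ p) < O.valuation (g₀ - f₀ ^ p)) →
    (∀ hk : ∀ c : k, algebraMap k K c ∈ O, transcendenceDefect k O hk ≠ 0) →
    (∃ π : K, π ≠ 0 ∧ (∀ x : K, O.valuation x < 1 → O.valuation x ≤ O.valuation π) ∧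
      (∀ x : K, x ≠ 0 → ∃ n : ℕ, O.valuation π ^ n ≤ O.valuation x)) →
    (∃ S : Finset K, (↑S : Set K) ⊆ O ∧
      ∀ y : K, y ∈ O → ∃ r : K, r ∈ Subring.closure ((locAtCentre A.toSubring O : Set K) ∪ ↑S) ∧ O.valuation (y - r) < 1) →
    g₀ ∈ Algebra.adjoin k (Set.range fun y : K => y ^ p) →
    ∃ (A' : Subalgebra k K), A'.toSubring ≤ O.toSubring ∧ A ≤ A' ∧ A'.FG ∧
    ∃ (_ : IsRegularLocalRing (locAtCentre A'.toSubring O)) (c : Fin p → K), (∃ j : Fin p, (j : ℕ) ≠ 0 ∧ c j ≠ 0) ∧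
    ((∃ (d m : ℕ) (hmd : m ≤ d) (t : Fin d → ↥(locAtCentre A'.toSubring O)) (a : Fin m → ℕ) (u : ↥(locAtCentre A'.toSubring O)), IsUnit u ∧
    Ideal.span (Set.range t) = IsLocalRing.maximalIdeal ↥(locAtCentre A'.toSubring O) ∧
    ringKrullDim ↥(locAtCentre A'.toSubring O) = (d : WithBot ℕ∞) ∧ 0 < m ∧ (∀ i, ¬ p ∣ a i) ∧
    (∑ j : Fin p, c j ^ p * g₀ ^ (j : ℕ)) = (u : K) * ∏ i : Fin m, ((t (Fin.castLE hmd i) : ↥(locAtCentre A'.toSubring O)) : K) ^ (a i)) ∨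
    (∃ u : ↥(locAtCentre A'.toSubring O), IsUnit u ∧ (∑ j : Fin p, c j ^ p * g₀ ^ (j : ℕ)) = (u : K) ∧
    ∀ c' : ↥(locAtCentre A'.toSubring O), u - c' ^ p ∉ IsLocalRing.maximalIdeal ↥(locAtCentre A'.toSubring O)) ∨
    (∃ s c' : ↥(locAtCentre A'.toSubring O), (∑ j : Fin p, c j ^ p * g₀ ^ (j : ℕ)) = (s : K) ∧
    s - c' ^ p ∈ IsLocalRing.maximalIdeal ↥(locAtCentre A'.toSubring O) ∧
    s - c' ^ p ∉ IsLocalRing.maximalIdeal ↥(locAtCentre A'.toSubring O) ^ 2)) :=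
  AbsDerivation.cleanLU3DefectArcConstants

/-- `stub_cleanLU3DefectArcInfinite` (Sketch rev 20 l.186) VERBATIM — THEOREM P ∘ LEMMA D-abs. [folklore] -/
theorem stub_cleanLU3DefectArcInfinite_closed :
    ∀ (p : ℕ), p.Prime →
    ∀ (k : Type) [Field k] [CharP k p] (K : Type) [Field K] [Algebra k K]
    (O : ValuationSubring K) (A : Subalgebra k K), A.toSubring ≤ O.toSubring → A.FG → IsFractionRing A K →
    ringKrullDim A ≤ 3 → IsRegularLocalRing (locAtCentre A.toSubring O) →
    ringKrullDim (locAtCentre A.toSubring O) = 3 →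
    (∀ (T : Subring K) (hT : T ≤ O.toSubring), A.toSubring ≤ T → (subringCentre T O hT).IsMaximal) →
    ∀ g₀ : K, (∀ c : K, c ^ p ≠ g₀) →
    (∀ f₀ : K, ∃ f₁ : K, O.valuation (g₀ - f₁ ^ p) < O.valuation (g₀ - f₀ ^ p)) →
    (∀ hk : ∀ c : k, algebraMap k K c ∈ O, transcendenceDefect k O hk ≠ 0) →
    (∃ π : K, π ≠ 0 ∧ (∀ x : K, O.valuation x < 1 → O.valuation x ≤ O.valuation π) ∧
      (∀ x : K, x ≠ 0 → ∃ n : ℕ, O.valuation π ^ n ≤ O.valuation x)) →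
    ¬ (∃ S : Finset K, (↑S : Set K) ⊆ O ∧
      ∀ y : K, y ∈ O → ∃ r : K, r ∈ Subring.closure ((locAtCentre A.toSubring O : Set K) ∪ ↑S) ∧ O.valuation (y - r) < 1) →
    ∃ (A' : Subalgebra k K), A'.toSubring ≤ O.toSubring ∧ A ≤ A' ∧ A'.FG ∧
    ∃ (_ : IsRegularLocalRing (locAtCentre A'.toSubring O)) (c : Fin p → K), (∃ j : Fin p, (j : ℕ) ≠ 0 ∧ c j ≠ 0) ∧
    ((∃ (d m : ℕ) (hmd : m ≤ d) (t : Fin d → ↥(locAtCentre A'.toSubring O)) (a : Fin m → ℕ) (u : ↥(locAtCentre A'.toSubring O)), IsUnit u ∧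
    Ideal.span (Set.range t) = IsLocalRing.maximalIdeal ↥(locAtCentre A'.toSubring O) ∧
    ringKrullDim ↥(locAtCentre A'.toSubring O) = (d : WithBot ℕ∞) ∧ 0 < m ∧ (∀ i, ¬ p ∣ a i) ∧
    (∑ j : Fin p, c j ^ p * g₀ ^ (j : ℕ)) = (u : K) * ∏ i : Fin m, ((t (Fin.castLE hmd i) : ↥(locAtCentre A'.toSubring O)) : K) ^ (a i)) ∨
    (∃ u : ↥(locAtCentre A'.toSubring O), IsUnit u ∧ (∑ j : Fin p, c j ^ p * g₀ ^ (j : ℕ)) = (u : K) ∧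
    ∀ c' : ↥(locAtCentre A'.toSubring O), u - c' ^ p ∉ IsLocalRing.maximalIdeal ↥(locAtCentre A'.toSubring O)) ∨
    (∃ s c' : ↥(locAtCentre A'.toSubring O), (∑ j : Fin p, c j ^ p * g₀ ^ (j : ℕ)) = (s : K) ∧
    s - c' ^ p ∈ IsLocalRing.maximalIdeal ↥(locAtCentre A'.toSubring O) ∧
    s - c' ^ p ∉ IsLocalRing.maximalIdeal ↥(locAtCentre A'.toSubring O) ^ 2)) :=
  ArcPotentialProof.cleanLU3DefectArcInfinite_of_absDerivation (fun _ hp => AbsDerivation.absDerivationMovesAt_holds hp)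

/-! ### §REV21 — the two class-(A) stubs of Sketch rev 21 (commit 9a6912239ef4, sha16 208b933e94a988b7), VERBATIM, closed

`stub_cleanLU3DefectArcImperfect` (rev 21 l.203) = rev-20 `stub_cleanLU3DefectArcInfinite` + three extra hypotheses (a derivation; ¬ perfect
residues; ¬ finite tower) — closed by DROPPING the first two and feeding the rest to `stub_cleanLU3DefectArcInfinite_closed` (THEOREM P; no
étale-local coefficient rings).  `stub_cleanLU3DefectArcConstants` (rev 21 l.243) carries `¬ ∃ (D : Derivation ℤ K K) s, …` together with `A.FG`,
`IsFractionRing A K`, `∀ c, c ^ p ≠ g₀` — CONTRADICTORY by `AbsDerivation.absDerivationMovesAt_holds` (D-abs, unconditional): closed EX FALSO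
(the «no absolute derivation» corner is EMPTY over every ground field).  Resolution in char `p` is NOT proved here. -/

/-- Sketch rev 21 `stub_cleanLU3DefectArcImperfect` (l.203–229) VERBATIM — PROVED (drop `hDer`, `hImp`; THEOREM P). [folklore] -/
theorem stub_cleanLU3DefectArcImperfect_closed :
    ∀ (p : ℕ), p.Prime →
    ∀ (k : Type) [Field k] [CharP k p] (K : Type) [Field K] [Algebra k K]
    (O : ValuationSubring K) (A : Subalgebra k K), A.toSubring ≤ O.toSubring → A.FG → IsFractionRing A K →
    ringKrullDim A ≤ 3 → IsRegularLocalRing (locAtCentre A.toSubring O) →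
    ringKrullDim (locAtCentre A.toSubring O) = 3 →
    (∀ (T : Subring K) (hT : T ≤ O.toSubring), A.toSubring ≤ T → (subringCentre T O hT).IsMaximal) →
    ∀ g₀ : K, (∀ c : K, c ^ p ≠ g₀) →
    (∀ f₀ : K, ∃ f₁ : K, O.valuation (g₀ - f₁ ^ p) < O.valuation (g₀ - f₀ ^ p)) →
    (∀ hk : ∀ c : k, algebraMap k K c ∈ O, transcendenceDefect k O hk ≠ 0) →
    (∃ π : K, π ≠ 0 ∧ (∀ x : K, O.valuation x < 1 → O.valuation x ≤ O.valuation π) ∧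
      (∀ x : K, x ≠ 0 → ∃ n : ℕ, O.valuation π ^ n ≤ O.valuation x)) →
    (∃ (D : Derivation ℤ K K) (s : K), s ≠ 0 ∧ (∀ y : K, y ∈ A → s * D y ∈ A) ∧ D g₀ ≠ 0) →
    ¬ (∀ (T : Subring K), T ≤ O.toSubring → A.toSubring ≤ T → ∀ r : K, r ∈ T → ∃ t : K, t ∈ T ∧ O.valuation (r - t ^ p) < 1) →
    ¬ (∃ S : Finset K, (↑S : Set K) ⊆ O ∧
      ∀ y : K, y ∈ O → ∃ r : K, r ∈ Subring.closure ((locAtCentre A.toSubring O : Set K) ∪ ↑S) ∧ O.valuation (y - r) < 1) →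
    ∃ (A' : Subalgebra k K), A'.toSubring ≤ O.toSubring ∧ A ≤ A' ∧ A'.FG ∧
    ∃ (_ : IsRegularLocalRing (locAtCentre A'.toSubring O)) (c : Fin p → K), (∃ j : Fin p, (j : ℕ) ≠ 0 ∧ c j ≠ 0) ∧
    ((∃ (d m : ℕ) (hmd : m ≤ d) (t : Fin d → ↥(locAtCentre A'.toSubring O)) (a : Fin m → ℕ) (u : ↥(locAtCentre A'.toSubring O)), IsUnit u ∧
    Ideal.span (Set.range t) = IsLocalRing.maximalIdeal ↥(locAtCentre A'.toSubring O) ∧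
    ringKrullDim ↥(locAtCentre A'.toSubring O) = (d : WithBot ℕ∞) ∧ 0 < m ∧ (∀ i, ¬ p ∣ a i) ∧
    (∑ j : Fin p, c j ^ p * g₀ ^ (j : ℕ)) = (u : K) * ∏ i : Fin m, ((t (Fin.castLE hmd i) : ↥(locAtCentre A'.toSubring O)) : K) ^ (a i)) ∨
    (∃ u : ↥(locAtCentre A'.toSubring O), IsUnit u ∧ (∑ j : Fin p, c j ^ p * g₀ ^ (j : ℕ)) = (u : K) ∧
    ∀ c' : ↥(locAtCentre A'.toSubring O), u - c' ^ p ∉ IsLocalRing.maximalIdeal ↥(locAtCentre A'.toSubring O)) ∨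
    (∃ s c' : ↥(locAtCentre A'.toSubring O), (∑ j : Fin p, c j ^ p * g₀ ^ (j : ℕ)) = (s : K) ∧
    s - c' ^ p ∈ IsLocalRing.maximalIdeal ↥(locAtCentre A'.toSubring O) ∧
    s - c' ^ p ∉ IsLocalRing.maximalIdeal ↥(locAtCentre A'.toSubring O) ^ 2)) :=
  fun p hp k _ _ K _ _ O A hAO hfg hfrac hdimA hreg hdim hzd g₀ hg hna htd hπ _hDer _hImp hS =>
    stub_cleanLU3DefectArcInfinite_closed p hp k K O A hAO hfg hfrac hdimA hreg hdim hzd g₀ hg hna htd hπ hS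

/-- Sketch rev 21 `stub_cleanLU3DefectArcConstants` (l.243–267) VERBATIM — PROVED EX FALSO: its hypothesis «no derivation of `K` moving `g₀`
and preserving `A` up to a denominator» contradicts D-abs `AbsDerivation.absDerivationMovesAt_holds`. [folklore] -/
theorem stub_cleanLU3DefectArcConstants_rev21_closed :
    ∀ (p : ℕ), p.Prime →
    ∀ (k : Type) [Field k] [CharP k p] (K : Type) [Field K] [Algebra k K]
    (O : ValuationSubring K) (A : Subalgebra k K), A.toSubring ≤ O.toSubring → A.FG → IsFractionRing A K →
    ringKrullDim A ≤ 3 → IsRegularLocalRing (locAtCentre A.toSubring O) →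
    ringKrullDim (locAtCentre A.toSubring O) = 3 →
    (∀ (T : Subring K) (hT : T ≤ O.toSubring), A.toSubring ≤ T → (subringCentre T O hT).IsMaximal) →
    ∀ g₀ : K, (∀ c : K, c ^ p ≠ g₀) →
    (∀ f₀ : K, ∃ f₁ : K, O.valuation (g₀ - f₁ ^ p) < O.valuation (g₀ - f₀ ^ p)) →
    (∀ hk : ∀ c : k, algebraMap k K c ∈ O, transcendenceDefect k O hk ≠ 0) →
    (∃ π : K, π ≠ 0 ∧ (∀ x : K, O.valuation x < 1 → O.valuation x ≤ O.valuation π) ∧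
      (∀ x : K, x ≠ 0 → ∃ n : ℕ, O.valuation π ^ n ≤ O.valuation x)) →
    ¬ (∃ (D : Derivation ℤ K K) (s : K), s ≠ 0 ∧ (∀ y : K, y ∈ A → s * D y ∈ A) ∧ D g₀ ≠ 0) →
    g₀ ∈ Algebra.adjoin k (Set.range fun y : K => y ^ p) →
    ∃ (A' : Subalgebra k K), A'.toSubring ≤ O.toSubring ∧ A ≤ A' ∧ A'.FG ∧
    ∃ (_ : IsRegularLocalRing (locAtCentre A'.toSubring O)) (c : Fin p → K), (∃ j : Fin p, (j : ℕ) ≠ 0 ∧ c j ≠ 0) ∧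
    ((∃ (d m : ℕ) (hmd : m ≤ d) (t : Fin d → ↥(locAtCentre A'.toSubring O)) (a : Fin m → ℕ) (u : ↥(locAtCentre A'.toSubring O)), IsUnit u ∧
    Ideal.span (Set.range t) = IsLocalRing.maximalIdeal ↥(locAtCentre A'.toSubring O) ∧
    ringKrullDim ↥(locAtCentre A'.toSubring O) = (d : WithBot ℕ∞) ∧ 0 < m ∧ (∀ i, ¬ p ∣ a i) ∧
    (∑ j : Fin p, c j ^ p * g₀ ^ (j : ℕ)) = (u : K) * ∏ i : Fin m, ((t (Fin.castLE hmd i) : ↥(locAtCentre A'.toSubring O)) : K) ^ (a i)) ∨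
    (∃ u : ↥(locAtCentre A'.toSubring O), IsUnit u ∧ (∑ j : Fin p, c j ^ p * g₀ ^ (j : ℕ)) = (u : K) ∧
    ∀ c' : ↥(locAtCentre A'.toSubring O), u - c' ^ p ∉ IsLocalRing.maximalIdeal ↥(locAtCentre A'.toSubring O)) ∨
    (∃ s c' : ↥(locAtCentre A'.toSubring O), (∑ j : Fin p, c j ^ p * g₀ ^ (j : ℕ)) = (s : K) ∧
    s - c' ^ p ∈ IsLocalRing.maximalIdeal ↥(locAtCentre A'.toSubring O) ∧
    s - c' ^ p ∉ IsLocalRing.maximalIdeal ↥(locAtCentre A'.toSubring O) ^ 2)) :=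
  fun _p hp k _ _ K _ _ _O A _hAO hfg hfrac _hdimA _hreg _hdim _hzd g₀ hg _hna _htd _hπ hnD _hadj =>
    absurd (AbsDerivation.absDerivationMovesAt_holds hp k K A hfg hfrac g₀ hg) hnD

/-! ### §REV22 — the two class-(A) stubs of Sketch rev 22 (commit a20320932482, sha16 266c193cec315648), VERBATIM, closed

Rev 22 inserts `¬ PerfectField k →` before the derivation hypothesis of both residual arc stubs; the proofs ignore it (THEOREM P and D-abs are
uniform in the ground field).  Resolution in char `p` is NOT proved here. -/

/-- Sketch rev 22 `stub_cleanLU3DefectArcImperfect` (l.209) VERBATIM — PROVED (drop `hImpK`, `hDer`, `hImp`; THEOREM P). [folklore] -/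
theorem stub_cleanLU3DefectArcImperfect_rev22_closed :
    ∀ (p : ℕ), p.Prime →
    ∀ (k : Type) [Field k] [CharP k p] (K : Type) [Field K] [Algebra k K]
    (O : ValuationSubring K) (A : Subalgebra k K), A.toSubring ≤ O.toSubring → A.FG → IsFractionRing A K →
    ringKrullDim A ≤ 3 → IsRegularLocalRing (locAtCentre A.toSubring O) →
    ringKrullDim (locAtCentre A.toSubring O) = 3 →
    (∀ (T : Subring K) (hT : T ≤ O.toSubring), A.toSubring ≤ T → (subringCentre T O hT).IsMaximal) →
    ∀ g₀ : K, (∀ c : K, c ^ p ≠ g₀) →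
    (∀ f₀ : K, ∃ f₁ : K, O.valuation (g₀ - f₁ ^ p) < O.valuation (g₀ - f₀ ^ p)) →
    (∀ hk : ∀ c : k, algebraMap k K c ∈ O, transcendenceDefect k O hk ≠ 0) →
    (∃ π : K, π ≠ 0 ∧ (∀ x : K, O.valuation x < 1 → O.valuation x ≤ O.valuation π) ∧
      (∀ x : K, x ≠ 0 → ∃ n : ℕ, O.valuation π ^ n ≤ O.valuation x)) →
    ¬ PerfectField k →
    (∃ (D : Derivation ℤ K K) (s : K), s ≠ 0 ∧ (∀ y : K, y ∈ A → s * D y ∈ A) ∧ D g₀ ≠ 0) →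
    ¬ (∀ (T : Subring K), T ≤ O.toSubring → A.toSubring ≤ T → ∀ r : K, r ∈ T → ∃ t : K, t ∈ T ∧ O.valuation (r - t ^ p) < 1) →
    ¬ (∃ S : Finset K, (↑S : Set K) ⊆ O ∧
      ∀ y : K, y ∈ O → ∃ r : K, r ∈ Subring.closure ((locAtCentre A.toSubring O : Set K) ∪ ↑S) ∧ O.valuation (y - r) < 1) →
    ∃ (A' : Subalgebra k K), A'.toSubring ≤ O.toSubring ∧ A ≤ A' ∧ A'.FG ∧
    ∃ (_ : IsRegularLocalRing (locAtCentre A'.toSubring O)) (c : Fin p → K), (∃ j : Fin p, (j : ℕ) ≠ 0 ∧ c j ≠ 0) ∧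
    ((∃ (d m : ℕ) (hmd : m ≤ d) (t : Fin d → ↥(locAtCentre A'.toSubring O)) (a : Fin m → ℕ) (u : ↥(locAtCentre A'.toSubring O)), IsUnit u ∧
    Ideal.span (Set.range t) = IsLocalRing.maximalIdeal ↥(locAtCentre A'.toSubring O) ∧
    ringKrullDim ↥(locAtCentre A'.toSubring O) = (d : WithBot ℕ∞) ∧ 0 < m ∧ (∀ i, ¬ p ∣ a i) ∧
    (∑ j : Fin p, c j ^ p * g₀ ^ (j : ℕ)) = (u : K) * ∏ i : Fin m, ((t (Fin.castLE hmd i) : ↥(locAtCentre A'.toSubring O)) : K) ^ (a i)) ∨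
    (∃ u : ↥(locAtCentre A'.toSubring O), IsUnit u ∧ (∑ j : Fin p, c j ^ p * g₀ ^ (j : ℕ)) = (u : K) ∧
    ∀ c' : ↥(locAtCentre A'.toSubring O), u - c' ^ p ∉ IsLocalRing.maximalIdeal ↥(locAtCentre A'.toSubring O)) ∨
    (∃ s c' : ↥(locAtCentre A'.toSubring O), (∑ j : Fin p, c j ^ p * g₀ ^ (j : ℕ)) = (s : K) ∧
    s - c' ^ p ∈ IsLocalRing.maximalIdeal ↥(locAtCentre A'.toSubring O) ∧
    s - c' ^ p ∉ IsLocalRing.maximalIdeal ↥(locAtCentre A'.toSubring O) ^ 2)) :=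
  fun p hp k _ _ K _ _ O A hAO hfg hfrac hdimA hreg hdim hzd g₀ hg hna htd hπ _hImpK _hDer _hImp hS =>
    stub_cleanLU3DefectArcInfinite_closed p hp k K O A hAO hfg hfrac hdimA hreg hdim hzd g₀ hg hna htd hπ hS

/-- Sketch rev 22 `stub_cleanLU3DefectArcConstants` (l.248) VERBATIM — PROVED EX FALSO (the «no derivation» hypothesis contradicts D-abs,
perfect or not). [folklore] -/
theorem stub_cleanLU3DefectArcConstants_rev22_closed :
    ∀ (p : ℕ), p.Prime →
    ∀ (k : Type) [Field k] [CharP k p] (K : Type) [Field K] [Algebra k K]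
    (O : ValuationSubring K) (A : Subalgebra k K), A.toSubring ≤ O.toSubring → A.FG → IsFractionRing A K →
    ringKrullDim A ≤ 3 → IsRegularLocalRing (locAtCentre A.toSubring O) →
    ringKrullDim (locAtCentre A.toSubring O) = 3 →
    (∀ (T : Subring K) (hT : T ≤ O.toSubring), A.toSubring ≤ T → (subringCentre T O hT).IsMaximal) →
    ∀ g₀ : K, (∀ c : K, c ^ p ≠ g₀) →
    (∀ f₀ : K, ∃ f₁ : K, O.valuation (g₀ - f₁ ^ p) < O.valuation (g₀ - f₀ ^ p)) →
    (∀ hk : ∀ c : k, algebraMap k K c ∈ O, transcendenceDefect k O hk ≠ 0) →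
    (∃ π : K, π ≠ 0 ∧ (∀ x : K, O.valuation x < 1 → O.valuation x ≤ O.valuation π) ∧
      (∀ x : K, x ≠ 0 → ∃ n : ℕ, O.valuation π ^ n ≤ O.valuation x)) →
    ¬ PerfectField k →
    ¬ (∃ (D : Derivation ℤ K K) (s : K), s ≠ 0 ∧ (∀ y : K, y ∈ A → s * D y ∈ A) ∧ D g₀ ≠ 0) →
    g₀ ∈ Algebra.adjoin k (Set.range fun y : K => y ^ p) →
    ∃ (A' : Subalgebra k K), A'.toSubring ≤ O.toSubring ∧ A ≤ A' ∧ A'.FG ∧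
    ∃ (_ : IsRegularLocalRing (locAtCentre A'.toSubring O)) (c : Fin p → K), (∃ j : Fin p, (j : ℕ) ≠ 0 ∧ c j ≠ 0) ∧
    ((∃ (d m : ℕ) (hmd : m ≤ d) (t : Fin d → ↥(locAtCentre A'.toSubring O)) (a : Fin m → ℕ) (u : ↥(locAtCentre A'.toSubring O)), IsUnit u ∧
    Ideal.span (Set.range t) = IsLocalRing.maximalIdeal ↥(locAtCentre A'.toSubring O) ∧
    ringKrullDim ↥(locAtCentre A'.toSubring O) = (d : WithBot ℕ∞) ∧ 0 < m ∧ (∀ i, ¬ p ∣ a i) ∧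
    (∑ j : Fin p, c j ^ p * g₀ ^ (j : ℕ)) = (u : K) * ∏ i : Fin m, ((t (Fin.castLE hmd i) : ↥(locAtCentre A'.toSubring O)) : K) ^ (a i)) ∨
    (∃ u : ↥(locAtCentre A'.toSubring O), IsUnit u ∧ (∑ j : Fin p, c j ^ p * g₀ ^ (j : ℕ)) = (u : K) ∧
    ∀ c' : ↥(locAtCentre A'.toSubring O), u - c' ^ p ∉ IsLocalRing.maximalIdeal ↥(locAtCentre A'.toSubring O)) ∨
    (∃ s c' : ↥(locAtCentre A'.toSubring O), (∑ j : Fin p, c j ^ p * g₀ ^ (j : ℕ)) = (s : K) ∧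
    s - c' ^ p ∈ IsLocalRing.maximalIdeal ↥(locAtCentre A'.toSubring O) ∧
    s - c' ^ p ∉ IsLocalRing.maximalIdeal ↥(locAtCentre A'.toSubring O) ^ 2)) :=
  fun _p hp k _ _ K _ _ _O A _hAO hfg hfrac _hdimA _hreg _hdim _hzd g₀ hg _hna _htd _hπ _hImpK hnD _hadj =>
    absurd (AbsDerivation.absDerivationMovesAt_holds hp k K A hfg hfrac g₀ hg) hnD

/-! ### §CANON — the canonical port target: CLASS (A) OVER EVERY GROUND FIELD, no side hypotheses

`cleanLU3DefectArc_discrete`: the rev-18 data of `stub_cleanLU3Defect` + `O` discrete of rank one (the `hπ` binder of the arc stubs) ⟹ the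
conclusion — no perfectness, no residue-field, no derivation, no residue-tower hypothesis.  This is the one theorem a later
`cleanLU3Defect_of_stubs` should consume for class (A): it subsumes the perfect-ground-field cases (✓p688393, ✓p689186) and every rev-20/21/22
residual arc stub.  Resolution in char `p` is NOT proved here. -/

/-- CLASS (A) over every ground field: rev-18 data + `O` discrete rank one ⟹ loose clean form (1)/(2)/(3) at a finitely generated model,
regular at the centre (THEOREM P + LEMMA D-abs). [folklore] -/
theorem cleanLU3DefectArc_discrete :
    ∀ (p : ℕ), p.Prime →
    ∀ (k : Type) [Field k] [CharP k p] (K : Type) [Field K] [Algebra k K]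
    (O : ValuationSubring K) (A : Subalgebra k K), A.toSubring ≤ O.toSubring → A.FG → IsFractionRing A K →
    ringKrullDim A ≤ 3 → IsRegularLocalRing (locAtCentre A.toSubring O) →
    ringKrullDim (locAtCentre A.toSubring O) = 3 →
    (∀ (T : Subring K) (hT : T ≤ O.toSubring), A.toSubring ≤ T → (subringCentre T O hT).IsMaximal) →
    ∀ g₀ : K, (∀ c : K, c ^ p ≠ g₀) →
    (∀ f₀ : K, ∃ f₁ : K, O.valuation (g₀ - f₁ ^ p) < O.valuation (g₀ - f₀ ^ p)) →
    (∀ hk : ∀ c : k, algebraMap k K c ∈ O, transcendenceDefect k O hk ≠ 0) →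
    (∃ π : K, π ≠ 0 ∧ (∀ x : K, O.valuation x < 1 → O.valuation x ≤ O.valuation π) ∧
      (∀ x : K, x ≠ 0 → ∃ n : ℕ, O.valuation π ^ n ≤ O.valuation x)) →
    ∃ (A' : Subalgebra k K), A'.toSubring ≤ O.toSubring ∧ A ≤ A' ∧ A'.FG ∧
    ∃ (_ : IsRegularLocalRing (locAtCentre A'.toSubring O)) (c : Fin p → K), (∃ j : Fin p, (j : ℕ) ≠ 0 ∧ c j ≠ 0) ∧
    ((∃ (d m : ℕ) (hmd : m ≤ d) (t : Fin d → ↥(locAtCentre A'.toSubring O)) (a : Fin m → ℕ) (u : ↥(locAtCentre A'.toSubring O)), IsUnit u ∧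
    Ideal.span (Set.range t) = IsLocalRing.maximalIdeal ↥(locAtCentre A'.toSubring O) ∧
    ringKrullDim ↥(locAtCentre A'.toSubring O) = (d : WithBot ℕ∞) ∧ 0 < m ∧ (∀ i, ¬ p ∣ a i) ∧
    (∑ j : Fin p, c j ^ p * g₀ ^ (j : ℕ)) = (u : K) * ∏ i : Fin m, ((t (Fin.castLE hmd i) : ↥(locAtCentre A'.toSubring O)) : K) ^ (a i)) ∨
    (∃ u : ↥(locAtCentre A'.toSubring O), IsUnit u ∧ (∑ j : Fin p, c j ^ p * g₀ ^ (j : ℕ)) = (u : K) ∧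
    ∀ c' : ↥(locAtCentre A'.toSubring O), u - c' ^ p ∉ IsLocalRing.maximalIdeal ↥(locAtCentre A'.toSubring O)) ∨
    (∃ s c' : ↥(locAtCentre A'.toSubring O), (∑ j : Fin p, c j ^ p * g₀ ^ (j : ℕ)) = (s : K) ∧
    s - c' ^ p ∈ IsLocalRing.maximalIdeal ↥(locAtCentre A'.toSubring O) ∧
    s - c' ^ p ∉ IsLocalRing.maximalIdeal ↥(locAtCentre A'.toSubring O) ^ 2)) :=
  fun p hp k _ _ K _ _ O A hAO hfg hfrac hdimA hreg hdim hzd g₀ hg hna htd hπ =>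
    ArcPotentialProof.cleanLU3DefectArc_of_derivation p hp k K O A hAO hfg hfrac hdimA hreg hdim hzd g₀ hg hna htd hπ
      (AbsDerivation.absDerivationMovesAt_holds hp k K A hfg hfrac g₀ hg)

end Summit.ResolutionOfSingularities.ResolutionOfSingularities.Cruxes.DescentPerfectToAll.CpSibling.ClassA

end
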